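import Literature.NumberTheory.Sieve.LinearEquationsInPrimesEnvelopingSieveGYCorrelations
import Literature.Analysis.Calculus.SmoothCutoff
import Literature.Analysis.Calculus.SmoothTransitionDerivatives
import HarnessLib

/-!
# Green–Tao (2008), Proposition 9.1 — a pseudorandom measure which majorises the modified primes (discharged)

Trunk T-SIEVE (`Literature/NumberTheory/Sieve`). B. Green, T. Tao, *The primes contain arbitrarily
long arithmetic progressions*, Ann. of Math. 167 (2008), 481–547, **Proposition 9.1** (p. 523): for
`k ≥ 3`, `ε_k = 1/(2^k (k+4)!)`, `w(N) → ∞` sufficiently slowly and `W = ∏_{p ≤ w(N)} p`, for all large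
primes `N` there is a `k`-pseudorandom measure `ν : ℤ_N → ℝ⁺` (Definition 3.3) with
`ν(n) ≥ k⁻¹2^{-k-5} Λ̃(n)` on `ε_k N ≤ n ≤ 2ε_k N`. This is the named fact
`Literature.NumberTheory.Sieve.GreenTao2008.PseudorandomMajorant` of `GreenTao2008.lean`; this file
proves `theorem PseudorandomMajorant_holds : PseudorandomMajorant`.

## The proof as formalised

The printed proof (§§9–10 and the Appendix) builds `ν` from the Goldston–Yıldırım divisor sum `Λ_R`
(Defs. 9.2–9.3) and derives its pseudorandomness (Props. 9.8, 9.10) from the correlation estimates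
Props. 9.5–9.6, whose proof is a contour integration against `ζ` using the classical zero-free region.
The tree already holds that reduction (`GreenTao2008Majorant*.lean`, `GreenTao2008LinearFormsProofs.lean`:
`PseudorandomMajorant_of_goldstonYildirim`), with Props. 9.5/9.6 as undischarged named facts. Since
Proposition 9.1 only asserts the EXISTENCE of a pseudorandom majorant, we discharge it instead with the
smoothly truncated divisor sum of Tao / Green–Tao 2010 (App. D) / Conlon–Fox–Zhao (Def. 8.2),
`Λ_{χ,R}(n) = log R ∑_{d ∣ n} μ(d) χ(log d/log R)`, for which the tree has PROVED Goldston–Yıldırım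
estimates by the elementary Fourier method (`SmoothMajorant*.lean`, `LinearEquationsInPrimesEnvelopingSieveGY*.lean`):

* the cutoff `χ₀(s) = sT(s+1) sT(1-s)` (`gtCutoff`; Mathlib's `Real.smoothTransition`, the tree's plateau
  cutoff `Literature.Analysis.Calculus.cutoff 1`): smooth, `[0,1]`-valued, `χ₀(0) = 1`, supported in
  `[-1,1]`, with `1 ≤ c_{χ₀} = ∫₀^∞ χ₀'² ≤ 2` (`one_le_cChi_gtCutoff`, `cChi_gtCutoff_le_two`, from the closed
  form of `sT'` and the bound `sT' ≤ 2`, `deriv_smoothTransition_le_two`) — an explicit cutoff is needed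
  because the level must be tuned to `c_{χ₀}`;
* the measure (`gtSmoothMeasure`): Definition 9.3 with `Λ_{χ₀,R}`, normaliser `c_{χ₀} log R`, and level
  `R = N^{γ_k}`, `γ_k = c_{χ₀} k⁻¹2^{-k-4}` (`gtSmoothExp`, `gtSmoothLevel`), so that `log R / c_{χ₀}` is
  exactly the printed `log R = k⁻¹2^{-k-4} log N` — this makes **Lemma 9.4** hold with the printed
  constant `k⁻¹2^{-k-5}` (`gtSmoothMeasure_majorises`), while `c_{χ₀} ≤ 2` keeps the boxes of the
  linear forms condition, of side `R^{10m}`, `m ≤ k2^{k-1}`, below `N^{5/8}` (`gtSmoothExp_mul_le`);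
* **Prop. 9.8** (`gtSmoothMeasure_linearFormsCondition`): the tree's generic localisation
  `linearFormsCondition_of_boxAsymptotic` (the `Q^t` boxes of pp. 526–528) fed with the level-free
  smooth box estimate `EnvelopingSieveGY.box_estimate` (CFZ Prop. 8.3 / Green–Tao 2010 Thm. D.3, proved);
* **Prop. 9.10** (`gtSmoothMeasure_correlationCondition`): the printed argument of pp. 529–530 in a
  generic form allowing an `O(1)` constant in the shift-correlation bound
  (`correlationCondition_of_shiftBound'`, reduced to the tree's `correlationCondition_of_shiftBound` by
  the rescaling `ν' = 1 + (ν-1)/C₀`, `correlationCondition_of_le_mul`), the shift bound itself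
  (`gtSmooth_shiftBound`, the rôle of Prop. 9.6) coming from the tree's proved fixed-data correlation
  estimate `EnvelopingSieveGY.corr_fixed_bound` (Green–Tao 2010 App. D) with
  `e^{δX} ≤ ∏_{p ∣ Δ}(1 + δ e^δ p^{-1/2})`, and `‖ν_N‖_∞ ≤ N^{o(1)}` from the divisor bound;
* the **assembly** of p. 530 (`PseudorandomMajorant_holds`), growth bound
  `G = min(G_{9.8}, G_{9.10}, ⌊log_4 log N⌋)`.

Nothing here restates the fact: `PseudorandomMajorant` is imported and only concluded. The printed
route through Props. 9.5/9.6 (sharp `Λ_R`, §10 and Appendix) is NOT discharged here and remains as the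
named facts `GoldstonYildirimLinearForms` / `GoldstonYildirimCorrelations` of `GreenTao2008Majorant.lean`.

## References

* B. Green, T. Tao, *The primes contain arbitrarily long arithmetic progressions*, Ann. of Math. (2)
  167 (2008), 481–547: Prop. 9.1 (p. 523), Def. 9.3, Lemma 9.4 (pp. 524–525), Props. 9.8, 9.10 and the
  proof of Prop. 9.1 (pp. 526–530). [cite: GreenTaoAnnals2008]
* D. Conlon, J. Fox, Y. Zhao, *The Green–Tao theorem: an exposition*, EMS Surv. Math. Sci. 1 (2014),
  249–282: Def. 8.2, Props. 8.1–8.4, §9. [cite: ConlonFoxZhao2014]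
* B. Green, T. Tao, *Linear equations in primes*, Ann. of Math. (2) 171 (2010), App. D, Thm. D.3.
  [cite: GreenTao2010]
-/

noncomputable section

open Filter Finset Topology MeasureTheory
open scoped BigOperators

namespace Literature.NumberTheory.Sieve.GreenTao2008

/-! ### An explicit cutoff with `1 ≤ c_χ ≤ 2` -/

/-- The derivative of Mathlib's smooth transition in closed form:
`sT'(x) = g(x) g(1-x) (x⁻² + (1-x)⁻²) / (g(x) + g(1-x))²`, `g = expNegInvGlue` (valid on all of
`ℝ`). [folklore] -/
theorem hasDerivAt_smoothTransition (x : ℝ) :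
    HasDerivAt Real.smoothTransition
      (expNegInvGlue x * expNegInvGlue (1 - x) * (x⁻¹ ^ 2 + (1 - x)⁻¹ ^ 2) /
        (expNegInvGlue x + expNegInvGlue (1 - x)) ^ 2) x := by
  have hg : ∀ y, HasDerivAt expNegInvGlue (y⁻¹ ^ 2 * expNegInvGlue y) y := fun y => by
    have h := (expNegInvGlue.contDiff (n := 1)).differentiable (by simp) y |>.hasDerivAt
    have hd : deriv expNegInvGlue y = y⁻¹ ^ 2 * expNegInvGlue y :=
      congrFun Literature.Analysis.Calculus.deriv_expNegInvGlue y
    rwa [hd] at h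
  have hsub : HasDerivAt (fun y : ℝ => 1 - y) (-1) x := (hasDerivAt_id' x).const_sub 1
  have h1 : HasDerivAt (fun y => expNegInvGlue (1 - y))
      ((1 - x)⁻¹ ^ 2 * expNegInvGlue (1 - x) * -1) x := (hg (1 - x)).comp x hsub
  have hden : HasDerivAt (fun y => expNegInvGlue y + expNegInvGlue (1 - y))
      (x⁻¹ ^ 2 * expNegInvGlue x + (1 - x)⁻¹ ^ 2 * expNegInvGlue (1 - x) * -1) x := (hg x).add h1
  have hpos := Real.smoothTransition.pos_denom x
  have hq : HasDerivAt Real.smoothTransition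
      ((x⁻¹ ^ 2 * expNegInvGlue x * (expNegInvGlue x + expNegInvGlue (1 - x)) -
        expNegInvGlue x * (x⁻¹ ^ 2 * expNegInvGlue x + (1 - x)⁻¹ ^ 2 * expNegInvGlue (1 - x) * -1)) /
        (expNegInvGlue x + expNegInvGlue (1 - x)) ^ 2) x := (hg x).div hden hpos.ne'
  convert hq using 1
  ring

/-- `sT' ≥ 0`. [folklore] -/
theorem deriv_smoothTransition_nonneg (x : ℝ) : 0 ≤ deriv Real.smoothTransition x := by
  rw [(hasDerivAt_smoothTransition x).deriv]
  have h1 := expNegInvGlue.nonneg x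
  have h2 := expNegInvGlue.nonneg (1 - x)
  positivity

/-- The key inequality behind `sT' ≤ 2`: for `a, b` with `ab = a + b` (i.e. `1/a + 1/b = 1`),
`e^{-a} e^{-b} (a² + b²) ≤ 2 (e^{-a} + e^{-b})²` — by `e^{b-a} + e^{a-b} = 2 cosh(a-b) ≥ 2 + (a-b)²`
(first two terms of the power series of `cosh`) this reduces to `(a-2)² + (b-2)² ≥ 0`. [folklore] -/
theorem exp_mul_sq_add_sq_le {a b : ℝ} (hab : a * b = a + b) :
    Real.exp (-a) * Real.exp (-b) * (a ^ 2 + b ^ 2) ≤ 2 * (Real.exp (-a) + Real.exp (-b)) ^ 2 := by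
  set A := Real.exp (-a) with hA
  set B := Real.exp (-b) with hB
  have hA0 : 0 < A := Real.exp_pos _
  have hB0 : 0 < B := Real.exp_pos _
  -- `1 + t²/2 ≤ cosh t`
  have hcosh0 : ∀ t : ℝ, 1 + t ^ 2 / 2 ≤ Real.cosh t := fun t => by
    have h := Real.hasSum_cosh t
    have h2 : ∑ n ∈ Finset.range 2, t ^ (2 * n) / ((2 * n).factorial : ℝ) = 1 + t ^ 2 / 2 := by
      simp [Finset.sum_range_succ, Nat.factorial]
    rw [← h2]
    exact sum_le_hasSum _ (fun n _ => div_nonneg (by rw [pow_mul]; positivity) (by positivity)) h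
  -- `A² + B² = AB (e^{b-a} + e^{a-b}) ≥ AB (2 + (a-b)²)`
  have hcosh : 2 + (a - b) ^ 2 ≤ Real.exp (b - a) + Real.exp (a - b) := by
    have h := hcosh0 (a - b)
    rw [Real.cosh_eq] at h
    have : Real.exp (-(a - b)) = Real.exp (b - a) := by rw [neg_sub]
    rw [this] at h
    linarith
  have hsq : A * B * (2 + (a - b) ^ 2) ≤ A ^ 2 + B ^ 2 := by
    have e1 : A ^ 2 = A * B * Real.exp (b - a) := by
      rw [sq, hA, hB, ← Real.exp_add, ← Real.exp_add, ← Real.exp_add]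
      congr 1; ring
    have e2 : B ^ 2 = A * B * Real.exp (a - b) := by
      rw [sq, hA, hB, ← Real.exp_add, ← Real.exp_add, ← Real.exp_add]
      congr 1; ring
    rw [e1, e2]
    nlinarith [mul_pos hA0 hB0]
  have hkey : a ^ 2 + b ^ 2 ≤ 8 + 2 * (a - b) ^ 2 := by
    nlinarith [sq_nonneg (a - 2), sq_nonneg (b - 2)]
  nlinarith [mul_pos hA0 hB0, mul_le_mul_of_nonneg_left hkey (mul_pos hA0 hB0).le]

/-- **`sT' ≤ 2`** for Mathlib's smooth transition. [folklore] -/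
theorem deriv_smoothTransition_le_two (x : ℝ) : deriv Real.smoothTransition x ≤ 2 := by
  rw [(hasDerivAt_smoothTransition x).deriv]
  have hpos := Real.smoothTransition.pos_denom x
  rw [div_le_iff₀ (by positivity)]
  rcases le_or_gt x 0 with hx | hx
  · rw [expNegInvGlue.zero_of_nonpos hx]
    simp only [zero_mul]
    positivity
  rcases le_or_gt 1 x with hx1 | hx1
  · rw [expNegInvGlue.zero_of_nonpos (show 1 - x ≤ 0 by linarith)]
    simp only [mul_zero, zero_mul]
    positivity
  -- `0 < x < 1`
  have hgx : expNegInvGlue x = Real.exp (-x⁻¹) := by simp [expNegInvGlue, not_le.2 hx]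
  have hg1x : expNegInvGlue (1 - x) = Real.exp (-(1 - x)⁻¹) := by
    simp [expNegInvGlue, not_le.2 (show 0 < 1 - x by linarith)]
  rw [hgx, hg1x]
  have hab : x⁻¹ * (1 - x)⁻¹ = x⁻¹ + (1 - x)⁻¹ := by
    have hx0 : x ≠ 0 := hx.ne'
    have hx1' : 1 - x ≠ 0 := by linarith
    field_simp
    ring
  have := exp_mul_sq_add_sq_le hab
  linarith

/-- **The cutoff `χ₀(s) = sT(s + 1) sT(1 - s)`** (the tree's plateau cutoff
`Literature.Analysis.Calculus.cutoff 1`): smooth, `[0,1]`-valued, `χ₀(0) = 1`, supported in `[-1, 1]`,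
and `χ₀(s) = sT(1 - s)` for `s ≥ 0`. [folklore] -/
def gtCutoff : ℝ → ℝ := Literature.Analysis.Calculus.cutoff 1

/-- Unfolding `χ₀`. [folklore] -/
theorem gtCutoff_def (s : ℝ) :
    gtCutoff s = Real.smoothTransition (s + 1) * Real.smoothTransition (1 - s) := rfl

/-- `χ₀(0) = 1`. [folklore] -/
theorem gtCutoff_zero : gtCutoff 0 = 1 :=
  Literature.Analysis.Calculus.cutoff_eq_one (by simp)

/-- `χ₀(s) = 0` for `|s| ≥ 1`. [folklore] -/
theorem gtCutoff_eq_zero {s : ℝ} (h : 1 ≤ |s|) : gtCutoff s = 0 :=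
  Literature.Analysis.Calculus.cutoff_eq_zero h

/-- `0 ≤ χ₀`. [folklore] -/
theorem gtCutoff_nonneg (s : ℝ) : 0 ≤ gtCutoff s := Literature.Analysis.Calculus.cutoff_nonneg 1 s

/-- `χ₀ ≤ 1`. [folklore] -/
theorem gtCutoff_le_one (s : ℝ) : gtCutoff s ≤ 1 := Literature.Analysis.Calculus.cutoff_le_one 1 s

/-- `|χ₀| ≤ 1`. [folklore] -/
theorem abs_gtCutoff_le_one (s : ℝ) : |gtCutoff s| ≤ 1 :=
  Literature.Analysis.Calculus.abs_cutoff_le_one 1 s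

/-- `χ₀` is smooth. [folklore] -/
theorem contDiff_gtCutoff : ContDiff ℝ (⊤ : ℕ∞) gtCutoff :=
  Literature.Analysis.Calculus.contDiff_cutoff 1

/-- `χ₀` is an admissible cutoff in the sense of Conlon–Fox–Zhao. [folklore] -/
theorem isSmoothCutoff_gtCutoff : IsSmoothCutoff gtCutoff :=
  ⟨contDiff_gtCutoff, gtCutoff_nonneg, gtCutoff_le_one, fun _ h => gtCutoff_eq_zero h⟩

/-- For `s ≥ 0`, `χ₀(s) = sT(1 - s)`. [folklore] -/
theorem gtCutoff_of_nonneg {s : ℝ} (hs : 0 ≤ s) : gtCutoff s = Real.smoothTransition (1 - s) := by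
  rw [gtCutoff_def, Real.smoothTransition.one_of_one_le (by linarith), one_mul]

/-- The derivative of `χ₀` on `[0, ∞)`: `χ₀'(s) = -sT'(1 - s)`. [folklore] -/
theorem hasDerivAt_gtCutoff_of_nonneg {s : ℝ} (hs : 0 ≤ s) :
    HasDerivAt gtCutoff (-deriv Real.smoothTransition (1 - s)) s := by
  have h := Literature.Analysis.Calculus.hasDerivAt_cutoff 1 s
  rw [Literature.Analysis.Calculus.deriv_smoothTransition_of_one_le (show 1 ≤ s + 1 by linarith),
    Real.smoothTransition.one_of_one_le (show 1 ≤ s + 1 by linarith), zero_mul, one_mul,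
    zero_sub] at h
  exact h

/-- `χ₀'(s) = -sT'(1 - s)` for `s ≥ 0`. [folklore] -/
theorem deriv_gtCutoff_of_nonneg {s : ℝ} (hs : 0 ≤ s) :
    deriv gtCutoff s = -deriv Real.smoothTransition (1 - s) :=
  (hasDerivAt_gtCutoff_of_nonneg hs).deriv

/-- `∫₀¹ sT'(1 - s) ds = 1` (fundamental theorem of calculus). [folklore] -/
theorem integral_deriv_smoothTransition_one_sub :
    ∫ s in (0 : ℝ)..1, deriv Real.smoothTransition (1 - s) = 1 := by
  have hderiv : ∀ s ∈ Set.uIcc (0 : ℝ) 1,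
      HasDerivAt (fun s => -Real.smoothTransition (1 - s)) (deriv Real.smoothTransition (1 - s)) s := by
    intro s _
    have h1 : HasDerivAt Real.smoothTransition (deriv Real.smoothTransition (1 - s)) (1 - s) :=
      (Literature.Analysis.Calculus.differentiable_smoothTransition _).hasDerivAt
    have hsub : HasDerivAt (fun y : ℝ => 1 - y) (-1) s := (hasDerivAt_id' s).const_sub 1
    have h2 : HasDerivAt (fun y => Real.smoothTransition (1 - y))
        (deriv Real.smoothTransition (1 - s) * -1) s := h1.comp s hsub
    have h3 : HasDerivAt (fun y => -Real.smoothTransition (1 - y))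
        (-(deriv Real.smoothTransition (1 - s) * -1)) s := h2.neg
    simpa using h3
  have hcont : Continuous fun s : ℝ => deriv Real.smoothTransition (1 - s) :=
    ((Real.smoothTransition.contDiff (n := 1)).continuous_deriv le_rfl).comp
      (continuous_const.sub continuous_id)
  rw [intervalIntegral.integral_eq_sub_of_hasDerivAt hderiv (hcont.intervalIntegrable _ _)]
  simp [Real.smoothTransition.one, Real.smoothTransition.zero]

/-- `c_{χ₀} = ∫₀¹ sT'(1 - s)² ds`. [folklore] -/
theorem cChi_gtCutoff_eq :
    cChi gtCutoff = ∫ s in (0 : ℝ)..1, deriv Real.smoothTransition (1 - s) ^ 2 := by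
  unfold cChi
  have h1 : ∫ s in Set.Ioi (0 : ℝ), deriv gtCutoff s ^ 2 =
      ∫ s in Set.Ioi (0 : ℝ), deriv Real.smoothTransition (1 - s) ^ 2 := by
    refine setIntegral_congr_fun measurableSet_Ioi fun s hs => ?_
    simp only [deriv_gtCutoff_of_nonneg (le_of_lt hs), neg_sq]
  rw [h1]
  have h2 : ∫ s in Set.Ioi (0 : ℝ), deriv Real.smoothTransition (1 - s) ^ 2 =
      ∫ s in Set.Ioc (0 : ℝ) 1, deriv Real.smoothTransition (1 - s) ^ 2 := by
    refine setIntegral_eq_of_subset_of_forall_sdiff_eq_zero measurableSet_Ioi Set.Ioc_subset_Ioi_self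
      fun s hs => ?_
    have hs1 : 1 < s := by
      rcases hs with ⟨h0, h1⟩
      by_contra h
      exact h1 ⟨h0, not_lt.1 h⟩
    rw [Literature.Analysis.Calculus.deriv_smoothTransition_of_nonpos (by linarith), zero_pow two_ne_zero]
  rw [h2, intervalIntegral.integral_of_le zero_le_one]

/-- **`c_{χ₀} ≤ 2`** (`sT'² ≤ 2 sT'` and `∫₀¹ sT'(1-s) ds = 1`). [folklore] -/
theorem cChi_gtCutoff_le_two : cChi gtCutoff ≤ 2 := by
  rw [cChi_gtCutoff_eq]
  have hcont : Continuous fun s : ℝ => deriv Real.smoothTransition (1 - s) :=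
    ((Real.smoothTransition.contDiff (n := 1)).continuous_deriv le_rfl).comp
      (continuous_const.sub continuous_id)
  calc ∫ s in (0 : ℝ)..1, deriv Real.smoothTransition (1 - s) ^ 2
      ≤ ∫ s in (0 : ℝ)..1, 2 * deriv Real.smoothTransition (1 - s) := by
        refine intervalIntegral.integral_mono_on zero_le_one ((hcont.pow 2).intervalIntegrable _ _)
          ((hcont.const_mul 2).intervalIntegrable _ _) fun s _ => ?_
        have h0 := deriv_smoothTransition_nonneg (1 - s)
        have h2 := deriv_smoothTransition_le_two (1 - s)
        nlinarith
    _ = 2 := by rw [intervalIntegral.integral_const_mul, integral_deriv_smoothTransition_one_sub, mul_one]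

/-- **`1 ≤ c_{χ₀}`** (`sT'² ≥ 2 sT' - 1`). [folklore] -/
theorem one_le_cChi_gtCutoff : 1 ≤ cChi gtCutoff := by
  rw [cChi_gtCutoff_eq]
  have hcont : Continuous fun s : ℝ => deriv Real.smoothTransition (1 - s) :=
    ((Real.smoothTransition.contDiff (n := 1)).continuous_deriv le_rfl).comp
      (continuous_const.sub continuous_id)
  calc (1 : ℝ) = ∫ s in (0 : ℝ)..1, (2 * deriv Real.smoothTransition (1 - s) - 1) := by
        rw [intervalIntegral.integral_sub ((hcont.const_mul 2).intervalIntegrable _ _)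
          (continuous_const.intervalIntegrable _ _),
          intervalIntegral.integral_const_mul, integral_deriv_smoothTransition_one_sub]
        norm_num
    _ ≤ ∫ s in (0 : ℝ)..1, deriv Real.smoothTransition (1 - s) ^ 2 := by
        refine intervalIntegral.integral_mono_on zero_le_one
          (((hcont.const_mul 2).sub continuous_const).intervalIntegrable _ _)
          ((hcont.pow 2).intervalIntegrable _ _) fun s _ => ?_
        nlinarith [sq_nonneg (deriv Real.smoothTransition (1 - s) - 1)]

/-- `0 < c_{χ₀}`. [folklore] -/
theorem cChi_gtCutoff_pos : 0 < cChi gtCutoff := lt_of_lt_of_le one_pos one_le_cChi_gtCutoff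

/-! ### The smooth majorant with level `R = N^γ`, `γ = c_{χ₀} k⁻¹ 2^{-k-4}` -/

/-- The level exponent `γ_k = c_{χ₀} · k⁻¹ 2^{-k-4}` (so that `log R / c_{χ₀} = k⁻¹2^{-k-4} log N`,
exactly Green–Tao's `log R` of Definition 9.3). [cite: GreenTaoAnnals2008, Definition 9.3] -/
def gtSmoothExp (k : ℕ) : ℝ := cChi gtCutoff * ((k : ℝ)⁻¹ * 2⁻¹ ^ (k + 4))

/-- The level `R = N^{γ_k}`. [cite: GreenTaoAnnals2008, Definition 9.3] -/
def gtSmoothLevel (k N : ℕ) : ℝ := (N : ℝ) ^ gtSmoothExp k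

/-- **The smooth Goldston–Yıldırım majorant** (Green–Tao's Definition 9.3 with Tao's smoothly
truncated divisor sum `Λ_{χ₀,R}` in place of `Λ_R`, normalised by `c_{χ₀} log R`, level `R = N^{γ_k}`):
`ν(n) = (φ(W)/W) Λ_{χ₀,R}(Wn+1)² / (c_{χ₀} log R)` for `ε_k N ≤ n ≤ 2ε_k N`, `ν(n) = 1` otherwise.
[cite: GreenTaoAnnals2008, Definition 9.3] [cite: ConlonFoxZhao2014, Proposition 8.4 eq. 8.2] -/
def gtSmoothMeasure (k : ℕ) (w : ℕ → ℕ) (N : ℕ) (x : ZMod N) : ℝ :=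
  if eps k * N ≤ (x.val : ℝ) ∧ (x.val : ℝ) ≤ 2 * eps k * N then
    (Nat.totient (primorial (w N)) : ℝ) / primorial (w N) *
      smoothDivisorSum gtCutoff (gtSmoothLevel k N) (primorial (w N) * x.val + 1) ^ 2 /
        (cChi gtCutoff * Real.log (gtSmoothLevel k N))
  else 1

/-- `γ_k > 0` for `k ≥ 1`. [cite: GreenTaoAnnals2008, Definition 9.3] -/
theorem gtSmoothExp_pos {k : ℕ} (hk : 1 ≤ k) : 0 < gtSmoothExp k := by
  unfold gtSmoothExp
  have hc := cChi_gtCutoff_pos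
  have hk0 : (0 : ℝ) < k := by exact_mod_cast hk
  positivity

/-- `γ_k ≥ 0`. [cite: GreenTaoAnnals2008, Definition 9.3] -/
theorem gtSmoothExp_nonneg (k : ℕ) : 0 ≤ gtSmoothExp k := by
  unfold gtSmoothExp
  have hc := cChi_gtCutoff_pos
  positivity

/-- The room in the exponent: `10 · (k 2^{k-1}) · γ_k = 10 c_{χ₀}/32 ≤ 5/8` (`c_{χ₀} ≤ 2`), so that the
boxes of side `R^{10 m}`, `m ≤ k 2^{k-1}`, are `o(N)`. [cite: GreenTaoAnnals2008, Proposition 9.8 (proof)] -/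
theorem gtSmoothExp_mul_le {k : ℕ} (hk : 1 ≤ k) :
    ((10 * (k * 2 ^ (k - 1)) : ℕ) : ℝ) * gtSmoothExp k ≤ 5 / 8 := by
  unfold gtSmoothExp
  have hc := cChi_gtCutoff_le_two
  have hc0 := cChi_gtCutoff_pos
  have hk0 : (0 : ℝ) < k := by exact_mod_cast hk
  have h2 : (2 : ℝ) ^ (k + 4) = 2 ^ (k - 1) * 32 := by
    rw [show k + 4 = (k - 1) + 5 by omega, pow_add]; norm_num
  have hpow : ((2 ^ (k - 1) : ℕ) : ℝ) * (2⁻¹ : ℝ) ^ (k + 4) = 1 / 32 := by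
    rw [inv_pow, h2]
    have : (0 : ℝ) < 2 ^ (k - 1) := by positivity
    push_cast
    field_simp
  calc ((10 * (k * 2 ^ (k - 1)) : ℕ) : ℝ) * (cChi gtCutoff * ((k : ℝ)⁻¹ * 2⁻¹ ^ (k + 4)))
      = 10 * cChi gtCutoff * ((k : ℝ) * (k : ℝ)⁻¹) * (((2 ^ (k - 1) : ℕ) : ℝ) * (2⁻¹ : ℝ) ^ (k + 4)) := by
        push_cast; ring
    _ = 10 * cChi gtCutoff / 32 := by rw [mul_inv_cancel₀ hk0.ne', hpow]; ring
    _ ≤ 10 * 2 / 32 := by gcongr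
    _ = 5 / 8 := by norm_num

/-- `γ_k ≤ 1/16 < 1`. [cite: GreenTaoAnnals2008, Definition 9.3] -/
theorem gtSmoothExp_le {k : ℕ} (hk : 1 ≤ k) : gtSmoothExp k ≤ 1 / 16 := by
  have h := gtSmoothExp_mul_le hk
  have h10 : (10 : ℝ) ≤ ((10 * (k * 2 ^ (k - 1)) : ℕ) : ℝ) := by
    have : 1 ≤ k * 2 ^ (k - 1) := Nat.mul_pos hk (Nat.two_pow_pos _)
    exact_mod_cast Nat.le_mul_of_pos_right 10 this
  have hγ := gtSmoothExp_nonneg k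
  nlinarith

/-- `R ≥ 0`. [cite: GreenTaoAnnals2008, Definition 9.3] -/
theorem gtSmoothLevel_nonneg (k N : ℕ) : 0 ≤ gtSmoothLevel k N :=
  Real.rpow_nonneg (Nat.cast_nonneg _) _

/-- `R > 0` for `N ≥ 1`. [cite: GreenTaoAnnals2008, Definition 9.3] -/
theorem gtSmoothLevel_pos {k N : ℕ} (hN : 1 ≤ N) : 0 < gtSmoothLevel k N :=
  Real.rpow_pos_of_pos (by exact_mod_cast hN) _

/-- `R ≥ 1` once `N ≥ 1`. [cite: GreenTaoAnnals2008, Definition 9.3] -/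
theorem one_le_gtSmoothLevel {k N : ℕ} (hN : 1 ≤ N) : 1 ≤ gtSmoothLevel k N :=
  Real.one_le_rpow (by exact_mod_cast hN) (gtSmoothExp_nonneg k)

/-- `log R = γ_k log N`. [cite: GreenTaoAnnals2008, Definition 9.3] -/
theorem log_gtSmoothLevel (k N : ℕ) : Real.log (gtSmoothLevel k N) = gtSmoothExp k * Real.log N := by
  rcases Nat.eq_zero_or_pos N with rfl | hN
  · unfold gtSmoothLevel
    by_cases he : gtSmoothExp k = 0
    · rw [he, Real.rpow_zero, Real.log_one, zero_mul]
    · rw [Nat.cast_zero, Real.zero_rpow he, Real.log_zero, mul_zero]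
  · unfold gtSmoothLevel
    exact Real.log_rpow (by exact_mod_cast hN) _

/-- `log R ≥ 0`. [cite: GreenTaoAnnals2008, Definition 9.3] -/
theorem log_gtSmoothLevel_nonneg (k N : ℕ) : 0 ≤ Real.log (gtSmoothLevel k N) := by
  rw [log_gtSmoothLevel]
  exact mul_nonneg (gtSmoothExp_nonneg k) (Real.log_natCast_nonneg N)

/-- `log R / c_{χ₀} = k⁻¹ 2^{-k-4} log N` (the point of the choice of `γ_k`).
[cite: GreenTaoAnnals2008, Definition 9.3] -/
theorem log_gtSmoothLevel_div (k N : ℕ) :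
    Real.log (gtSmoothLevel k N) / cChi gtCutoff = (k : ℝ)⁻¹ * 2⁻¹ ^ (k + 4) * Real.log N := by
  rw [log_gtSmoothLevel, gtSmoothExp]
  have hc := cChi_gtCutoff_pos
  field_simp

/-- `log R → ∞` (`k ≥ 1`). [cite: GreenTaoAnnals2008, Definition 9.3] -/
theorem tendsto_log_gtSmoothLevel {k : ℕ} (hk : 1 ≤ k) :
    Tendsto (fun N : ℕ => Real.log (gtSmoothLevel k N)) atTop atTop := by
  simp_rw [log_gtSmoothLevel]
  exact Tendsto.const_mul_atTop (gtSmoothExp_pos hk) (Real.tendsto_log_atTop.comp tendsto_natCast_atTop_atTop)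

/-- `R^a ≤ N^b` whenever `a γ_k ≤ b`, `N ≥ 1`. [cite: GreenTaoAnnals2008, Definition 9.3] -/
theorem gtSmoothLevel_pow_le_rpow {k N a : ℕ} {b : ℝ} (hN : 1 ≤ N) (hab : (a : ℝ) * gtSmoothExp k ≤ b) :
    gtSmoothLevel k N ^ a ≤ (N : ℝ) ^ b := by
  have hN1 : (1 : ℝ) ≤ N := by exact_mod_cast hN
  unfold gtSmoothLevel
  rw [← Real.rpow_natCast, ← Real.rpow_mul (by positivity)]
  exact Real.rpow_le_rpow_of_exponent_le hN1 (by rw [mul_comm]; exact hab)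

/-- `R^{5m} ≤ N` for `m ≤ 2^{k-1}` (`5 · 2^{k-1} γ_k ≤ 5/16`): the interval `[-N, N]` is long enough
for the correlation estimate. [cite: GreenTaoAnnals2008, Proposition 9.10 (proof)] -/
theorem gtSmoothLevel_pow_five_le {k m N : ℕ} (hk : 1 ≤ k) (hm : m ≤ 2 ^ (k - 1)) (hN : 1 ≤ N) :
    gtSmoothLevel k N ^ (5 * m) ≤ N := by
  have h := gtSmoothExp_mul_le hk
  have hγ := gtSmoothExp_nonneg k
  have hle : ((5 * m : ℕ) : ℝ) * gtSmoothExp k ≤ 1 := by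
    have h1 : ((5 * m : ℕ) : ℝ) ≤ ((10 * (k * 2 ^ (k - 1)) : ℕ) : ℝ) := by
      have : 5 * m ≤ 10 * (k * 2 ^ (k - 1)) := by
        calc 5 * m ≤ 5 * 2 ^ (k - 1) := by omega
          _ ≤ 10 * (1 * 2 ^ (k - 1)) := by omega
          _ ≤ 10 * (k * 2 ^ (k - 1)) := by gcongr
      exact_mod_cast this
    nlinarith
  have := gtSmoothLevel_pow_le_rpow (k := k) (a := 5 * m) hN hle
  rwa [Real.rpow_one] at this

/-- `R^{10 m₀} / N → 0` for `m₀ = k 2^{k-1}` (`R^{10 m₀} ≤ N^{5/8}`).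
[cite: GreenTaoAnnals2008, Proposition 9.8 (proof)] -/
theorem tendsto_gtSmoothLevel_pow_div_atTop {k : ℕ} (hk : 1 ≤ k) :
    Tendsto (fun N : ℕ => gtSmoothLevel k N ^ (10 * (k * 2 ^ (k - 1))) / N) atTop (𝓝 0) := by
  have hlim : Tendsto (fun N : ℕ => (N : ℝ) ^ (-(3 / 8 : ℝ))) atTop (𝓝 0) :=
    (tendsto_rpow_neg_atTop (by norm_num)).comp tendsto_natCast_atTop_atTop
  refine squeeze_zero' (Eventually.of_forall fun N => by
    have := gtSmoothLevel_nonneg k N; positivity) ?_ hlim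
  filter_upwards [eventually_ge_atTop 1] with N hN
  have hN0 : (0 : ℝ) < N := by exact_mod_cast hN
  have h := gtSmoothLevel_pow_le_rpow (k := k) (a := 10 * (k * 2 ^ (k - 1))) (b := 5 / 8) hN (gtSmoothExp_mul_le hk)
  rw [div_le_iff₀ hN0]
  calc gtSmoothLevel k N ^ (10 * (k * 2 ^ (k - 1))) ≤ (N : ℝ) ^ (5 / 8 : ℝ) := h
    _ = (N : ℝ) ^ (-(3 / 8 : ℝ)) * N := by
        rw [← Real.rpow_add_one hN0.ne']; norm_num

/-- `R / N → 0`. [cite: GreenTaoAnnals2008, Definition 9.3] -/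
theorem tendsto_gtSmoothLevel_div_atTop {k : ℕ} (hk : 1 ≤ k) :
    Tendsto (fun N : ℕ => gtSmoothLevel k N / N) atTop (𝓝 0) := by
  refine squeeze_zero' (Eventually.of_forall fun N => by
    have := gtSmoothLevel_nonneg k N; positivity) ?_ (tendsto_gtSmoothLevel_pow_div_atTop hk)
  filter_upwards [eventually_ge_atTop 1] with N hN
  have hR1 := one_le_gtSmoothLevel (k := k) hN
  have hpos : 0 < 10 * (k * 2 ^ (k - 1)) := Nat.mul_pos (by norm_num) (Nat.mul_pos hk (Nat.two_pow_pos _))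
  gcongr
  calc gtSmoothLevel k N = gtSmoothLevel k N ^ 1 := (pow_one _).symm
    _ ≤ gtSmoothLevel k N ^ (10 * (k * 2 ^ (k - 1))) := pow_le_pow_right₀ hR1 hpos

/-- `ν ≥ 0`. [cite: GreenTaoAnnals2008, Lemma 9.4] -/
theorem gtSmoothMeasure_nonneg (k : ℕ) (w : ℕ → ℕ) (N : ℕ) (x : ZMod N) : 0 ≤ gtSmoothMeasure k w N x := by
  unfold gtSmoothMeasure
  split_ifs
  · exact div_nonneg (mul_nonneg (div_nonneg (Nat.cast_nonneg _) (Nat.cast_nonneg _)) (sq_nonneg _))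
      (mul_nonneg cChi_gtCutoff_pos.le (log_gtSmoothLevel_nonneg k N))
  · exact zero_le_one

/-- **Lemma 9.4 for the smooth majorant:** on the window, for `R ≥ 1`, `R < ε_k N` and `W ≤ N`,
`k⁻¹2^{-k-5} Λ̃(n) ≤ ν(n)`: if `Wn + 1 = p` is prime then `p > R`, `Λ_{χ₀,R}(p) = log R`, and
`ν(n) = (φ(W)/W) log R / c_{χ₀} = (φ(W)/W) k⁻¹2^{-k-4} log N ≥ (φ(W)/W) k⁻¹2^{-k-5} log(Wn+1)` as
`Wn + 1 ≤ N²`; otherwise `Λ̃(n) = 0`. [cite: GreenTaoAnnals2008, Lemma 9.4] -/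
theorem gtSmoothMeasure_majorises {k : ℕ} (hk : 1 ≤ k) {w : ℕ → ℕ} {N n : ℕ}
    (hWN : primorial (w N) ≤ N) (hR1 : 1 ≤ gtSmoothLevel k N) (hRε : gtSmoothLevel k N < eps k * N)
    (h1 : eps k * N ≤ n) (h2 : (n : ℝ) ≤ 2 * eps k * N) :
    (k : ℝ)⁻¹ * 2⁻¹ ^ (k + 5) * modifiedVonMangoldt (primorial (w N)) n ≤
      gtSmoothMeasure k w N (n : ZMod N) := by
  set W : ℕ := primorial (w N) with hW_def
  have hW0 : 0 < W := primorial_pos _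
  have hN0 : (0 : ℝ) < N := by
    have h0 : 0 < eps k * N := lt_of_le_of_lt (gtSmoothLevel_nonneg k N) hRε
    by_contra h
    push Not at h
    have : eps k * N ≤ 0 := mul_nonpos_of_nonneg_of_nonpos (eps_pos k).le h
    linarith
  have hnN' : (n : ℝ) < N := by
    have := two_mul_eps_lt_one k
    calc (n : ℝ) ≤ 2 * eps k * N := h2
      _ < 1 * N := by gcongr
      _ = N := one_mul _
  have hnN : n < N := by exact_mod_cast hnN'
  haveI : NeZero N := ⟨by omega⟩
  have hv : (n : ZMod N).val = n := ZMod.val_cast_of_lt hnN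
  by_cases hp : (W * n + 1).Prime
  · have hpR : gtSmoothLevel k N < ((W * n + 1 : ℕ) : ℝ) := by
      have h3 : (n : ℝ) ≤ W * n := by
        have : (1 : ℝ) ≤ W := by exact_mod_cast hW0
        nlinarith [Nat.cast_nonneg (α := ℝ) n]
      push_cast
      linarith
    have hΛ : smoothDivisorSum gtCutoff (gtSmoothLevel k N) (W * n + 1 : ℕ) = Real.log (gtSmoothLevel k N) := by
      rw [smoothDivisorSum_prime gtCutoff hp hR1 hpR, gtCutoff_zero, one_mul]
    unfold gtSmoothMeasure
    rw [hv, if_pos ⟨h1, h2⟩, modifiedVonMangoldt_eq, if_pos hp]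
    have hcast : ((W : ℤ) * (n : ℤ) + 1 : ℤ) = ((W * n + 1 : ℕ) : ℤ) := by push_cast; ring
    rw [hcast, hΛ]
    have hc := cChi_gtCutoff_pos
    have hN2 : (2 : ℝ) ≤ N := by
      have : 1 < N := by
        by_contra h
        push Not at h
        have hn0 : n = 0 := by omega
        subst hn0
        have : eps k * N ≤ 0 := by exact_mod_cast h1
        linarith [lt_of_le_of_lt (gtSmoothLevel_nonneg k N) hRε]
      exact_mod_cast this
    have hlogN : 0 < Real.log N := Real.log_pos (by linarith)
    have hlogR : 0 < Real.log (gtSmoothLevel k N) := by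
      rw [log_gtSmoothLevel]
      exact mul_pos (gtSmoothExp_pos hk) hlogN
    have hlogp : Real.log ((W : ℝ) * n + 1) ≤ 2 * Real.log N := by
      have hle : (W : ℝ) * n + 1 ≤ (N : ℝ) ^ 2 := by
        have hW' : (W : ℝ) ≤ N := by exact_mod_cast hWN
        have hn1 : (n : ℝ) + 1 ≤ N := by exact_mod_cast hnN
        nlinarith [Nat.cast_nonneg (α := ℝ) n, Nat.cast_nonneg (α := ℝ) W]
      calc Real.log ((W : ℝ) * n + 1) ≤ Real.log ((N : ℝ) ^ 2) :=
            Real.log_le_log (by positivity) hle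
        _ = 2 * Real.log N := by rw [Real.log_pow]; norm_num
    -- `k⁻¹ 2^{-k-5} log(W n + 1) ≤ k⁻¹ 2^{-k-4} log N = log R / c`
    have hkey : (k : ℝ)⁻¹ * 2⁻¹ ^ (k + 5) * Real.log ((W : ℝ) * n + 1) ≤
        Real.log (gtSmoothLevel k N) / cChi gtCutoff := by
      rw [log_gtSmoothLevel_div]
      calc (k : ℝ)⁻¹ * 2⁻¹ ^ (k + 5) * Real.log ((W : ℝ) * n + 1)
          ≤ (k : ℝ)⁻¹ * 2⁻¹ ^ (k + 5) * (2 * Real.log N) := by gcongr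
        _ = (k : ℝ)⁻¹ * 2⁻¹ ^ (k + 4) * Real.log N := by ring
    have hφ : 0 ≤ (Nat.totient W : ℝ) / W := by positivity
    calc (k : ℝ)⁻¹ * 2⁻¹ ^ (k + 5) * ((Nat.totient W : ℝ) / W * Real.log ((W : ℝ) * n + 1))
        = (Nat.totient W : ℝ) / W * ((k : ℝ)⁻¹ * 2⁻¹ ^ (k + 5) * Real.log ((W : ℝ) * n + 1)) := by ring
      _ ≤ (Nat.totient W : ℝ) / W * (Real.log (gtSmoothLevel k N) / cChi gtCutoff) := by gcongr
      _ = (Nat.totient W : ℝ) / W * Real.log (gtSmoothLevel k N) ^ 2 /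
            (cChi gtCutoff * Real.log (gtSmoothLevel k N)) := by
          field_simp
  · rw [modifiedVonMangoldt_eq, if_neg hp, mul_zero]
    exact gtSmoothMeasure_nonneg k w N _

/-! ### The linear forms condition (Green–Tao Prop. 9.8 / CFZ Prop. 8.4) for the smooth majorant -/

/-- **The `(k 2^{k-1}, 3k-4, k)`-linear forms condition for the smooth majorant**, for `w → ∞` below
the growth bound `G(N) = ⌊(log R)^{1/8}⌋` (the range of the engine): the tree's generic localisation
`linearFormsCondition_of_boxAsymptotic` (the `Q^t` boxes of the printed proof of Prop. 9.8, pp. 526–528)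
fed with the PROVED level-free smooth Goldston–Yıldırım box estimate
`EnvelopingSieveGY.box_estimate` (CFZ Prop. 8.3 / Green–Tao 2010 Thm. D.3) at the level `R = N^{γ_k}`,
with `F_N(n) = (φ(W)/W) Λ_{χ₀,R}(Wn+1)²/(c_{χ₀} log R)` and `θ(N) = R^{10 k 2^{k-1}} ≤ N^{5/8}`.
[cite: GreenTaoAnnals2008, Proposition 9.8] [cite: ConlonFoxZhao2014, Propositions 8.3 and 8.4] -/
theorem gtSmoothMeasure_linearFormsCondition {k : ℕ} (hk : 3 ≤ k) :
    ∃ G : ℕ → ℕ, Tendsto G atTop atTop ∧ ∀ w : ℕ → ℕ, Tendsto w atTop atTop → (∀ N, w N ≤ G N) →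
      LinearFormsCondition (k * 2 ^ (k - 1)) (3 * k - 4) k (gtSmoothMeasure k w) := by
  classical
  have hk1 : 1 ≤ k := by omega
  set m₀ : ℕ := k * 2 ^ (k - 1) with hm₀_def
  -- the growth bound: the range `w ≤ (log R)^{1/8}` of the engine
  set G : ℕ → ℕ := fun N => ⌊Real.log (gtSmoothLevel k N) ^ (1 / 8 : ℝ)⌋₊ with hG_def
  have hG : Tendsto G atTop atTop :=
    tendsto_nat_floor_atTop.comp ((tendsto_rpow_atTop (by norm_num)).comp (tendsto_log_gtSmoothLevel hk1))
  refine ⟨G, hG, fun w hw hwG => ?_⟩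
  have hwR : ∀ N, (w N : ℝ) ≤ Real.log (gtSmoothLevel k N) ^ (1 / 8 : ℝ) := fun N =>
    (show (w N : ℝ) ≤ (G N : ℝ) by exact_mod_cast hwG N).trans
      (Nat.floor_le (Real.rpow_nonneg (log_gtSmoothLevel_nonneg k N) _))
  -- the function `F_N`
  set F : ℕ → ℤ → ℝ := fun N n =>
    (Nat.totient (primorial (w N)) : ℝ) / primorial (w N) *
      smoothDivisorSum gtCutoff (gtSmoothLevel k N) (primorial (w N) * n + 1) ^ 2 /
        (cChi gtCutoff * Real.log (gtSmoothLevel k N)) with hF_def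
  have hF0 : ∀ N n, 0 ≤ F N n := fun N n =>
    div_nonneg (mul_nonneg (div_nonneg (Nat.cast_nonneg _) (Nat.cast_nonneg _)) (sq_nonneg _))
      (mul_nonneg cChi_gtCutoff_pos.le (log_gtSmoothLevel_nonneg k N))
  have hν : ∀ N (x : ZMod N), gtSmoothMeasure k w N x = if InWindow (eps k) N x.val then F N x.val else 1 := by
    intro N x
    by_cases hcw : eps k * N ≤ (x.val : ℝ) ∧ (x.val : ℝ) ≤ 2 * eps k * N
    · have hc' : InWindow (eps k) N x.val := by simpa [InWindow] using hcw
      rw [if_pos hc']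
      unfold gtSmoothMeasure
      rw [if_pos hcw]
    · have hc' : ¬ InWindow (eps k) N x.val := by simpa [InWindow] using hcw
      rw [if_neg hc']
      unfold gtSmoothMeasure
      rw [if_neg hcw]
  refine linearFormsCondition_of_boxAsymptotic F (eps_pos k) (two_mul_eps_lt_one k) hν hF0
    (fun N => gtSmoothLevel k N ^ (10 * m₀)) (tendsto_gtSmoothLevel_pow_div_atTop hk1) ?_
  -- the box asymptotic from the smooth Goldston–Yıldırım engine
  intro m t hm1 hmm₀ ht1 _htt₀ ε hε
  obtain ⟨n, rfl⟩ : ∃ n, t = n + 1 := ⟨t - 1, by omega⟩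
  obtain ⟨K₁, hK₁1, w₀, H⟩ := EnvelopingSieveGY.box_estimate (χ := gtCutoff) contDiff_gtCutoff
    (fun x h => gtCutoff_eq_zero h) abs_gtCutoff_le_one cChi_gtCutoff_pos m n (k * k.factorial) hm1 hε
  filter_upwards [(tendsto_log_gtSmoothLevel hk1).eventually_ge_atTop K₁, hw.eventually_ge_atTop w₀,
    eventually_ge_atTop 1] with N hK₁ hw₀ hN1 _hNp L hL hL0 hLp b a ℓ hℓ
  set W : ℕ := primorial (w N) with hW_def
  set R : ℝ := gtSmoothLevel k N with hR_def
  have hR0 : 0 < R := gtSmoothLevel_pos hN1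
  have hR1 : 1 ≤ R := one_le_gtSmoothLevel hN1
  have hW0 : (0 : ℝ) < W := by exact_mod_cast primorial_pos (w N)
  have hφ0 : (0 : ℝ) < Nat.totient W := by exact_mod_cast Nat.totient_pos.2 (primorial_pos (w N))
  have hlogR0 : 0 < Real.log R := by
    have : K₁ ≤ Real.log R := hK₁
    linarith
  set M : ℝ := cChi gtCutoff * (W : ℝ) * Real.log R / Nat.totient W with hM_def
  have hM0 : 0 < M := by have := cChi_gtCutoff_pos; positivity
  have hFM : ∀ z : ℤ, F N z = M⁻¹ * smoothDivisorSum gtCutoff R ((W : ℤ) * z + 1) ^ 2 := by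
    intro z
    simp only [hF_def, hM_def, hW_def, hR_def]
    have := cChi_gtCutoff_pos
    field_simp
  have hL' : ∀ i j, |L i j| ≤ ((k * k.factorial : ℕ) : ℤ) := fun i j => by push_cast; exact hL i j
  have hℓ' : ∀ j, R ^ (10 * m) ≤ ℓ j := fun j =>
    le_trans (pow_le_pow_right₀ hR1 (by nlinarith)) (hℓ j)
  have hbox := H R hR0 hK₁ (w N) hw₀ (hwR N) L hL' hL0 hLp b a ℓ hℓ'
  have hprod : ∀ x : Fin (n + 1) → ℤ, ∏ i, F N (∑ j, L i j * x j + b i) =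
      M⁻¹ ^ m * ∏ i, smoothDivisorSum gtCutoff R ((W : ℤ) * (∑ j, L i j * x j + b i) + 1) ^ 2 := by
    intro x
    rw [prod_congr rfl fun i _ => hFM _, prod_mul_distrib, prod_const, card_univ, Fintype.card_fin]
  simp_rw [hprod]
  rw [← mul_expect, inv_pow, ← div_eq_inv_mul]
  exact hbox

/-! ### The correlation condition: a generic form with an arbitrary constant -/

/-- **Transfer of the correlation condition along `ν ≤ C₀ ν'`:** if `0 ≤ ν ≤ C₀ ν'` pointwise and
`ν'` satisfies the `m₀`-correlation condition with weights `τ_m`, then `ν` satisfies it with the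
weights `C₀^m τ_m` (Definition 3.2 only asks for an upper bound and bounded moments).
[cite: GreenTaoAnnals2008, Definition 3.2] -/
theorem correlationCondition_of_le_mul {m₀ : ℕ} {ν ν' : (N : ℕ) → ZMod N → ℝ} {C₀ : ℝ} (hC₀ : 0 ≤ C₀)
    (hν0 : ∀ N x, 0 ≤ ν N x) (hle : ∀ N x, ν N x ≤ C₀ * ν' N x) (h : CorrelationCondition m₀ ν') :
    CorrelationCondition m₀ ν := by
  classical
  intro m hm1 hm2
  obtain ⟨τ, hτ0, hmom, hbd⟩ := h m hm1 hm2
  refine ⟨fun N x => C₀ ^ m * τ N x, fun N x => mul_nonneg (pow_nonneg hC₀ _) (hτ0 N x), ?_, ?_⟩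
  · intro q hq
    obtain ⟨C, hC⟩ := hmom q hq
    refine ⟨(C₀ ^ m) ^ q * C, ?_⟩
    filter_upwards [hC] with N hN hprime
    have h1 : 𝔼 x : ZMod N, τ N x ^ q ≤ C := hN
    calc 𝔼 x : ZMod N, (C₀ ^ m * τ N x) ^ q = 𝔼 x : ZMod N, (C₀ ^ m) ^ q * τ N x ^ q := by
          simp_rw [mul_pow]
      _ = (C₀ ^ m) ^ q * 𝔼 x : ZMod N, τ N x ^ q := by rw [← mul_expect]
      _ ≤ (C₀ ^ m) ^ q * C := by gcongr
  · filter_upwards [hbd] with N hN hprime h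
    have h1 : 𝔼 x : ZMod N, ∏ i, ν' N (x + h i) ≤ ∑ i : Fin m, ∑ j : Fin m with i < j, τ N (h i - h j) :=
      hN h
    calc 𝔼 x : ZMod N, ∏ i, ν N (x + h i) ≤ 𝔼 x : ZMod N, ∏ i, (C₀ * ν' N (x + h i)) :=
          expect_le_expect fun x _ => prod_le_prod (fun i _ => hν0 _ _) (fun i _ => hle _ _)
      _ = 𝔼 x : ZMod N, C₀ ^ m * ∏ i, ν' N (x + h i) := by
          refine expect_congr rfl fun x _ => ?_
          rw [prod_mul_distrib, prod_const, card_univ, Fintype.card_fin]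
      _ = C₀ ^ m * 𝔼 x : ZMod N, ∏ i, ν' N (x + h i) := by rw [← mul_expect]
      _ ≤ C₀ ^ m * ∑ i : Fin m, ∑ j : Fin m with i < j, τ N (h i - h j) := by gcongr
      _ = ∑ i : Fin m, ∑ j : Fin m with i < j, C₀ ^ m * τ N (h i - h j) := by
          rw [mul_sum]
          exact sum_congr rfl fun i _ => mul_sum _ _ _

/-- **Green–Tao 2008, Proposition 9.10, generic form with an arbitrary constant in the shift bound.**
As the tree's `correlationCondition_of_shiftBound` (`ν ≥ 0`, `ν_N ≤ 1 + g_N`, `g_N ≥ 0` supported in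
`[ε₀N, 2ε₀N]`, `ε₀ < 1/4`, `‖g_N‖_∞ ≤ N^{o(1)}`), but with the Goldston–Yıldırım type correlation bound
in the weaker form `∑_{y<N} ∏_i g_N(y + h_i) ≤ C_m N ∏_{p ∣ Δ}(1 + C_m p^{-1/2})` for distinct
`|h_i| ≤ N` — an `O(1)` rather than `1 + o(1)` — which is all the printed argument uses (the constant
joins the `O_m(1)` in front of `τ`). Reduced to the tree's statement through the rescaled family
`ν' = 1 + (ν - 1)/C₀ ≤ 1 + g/C₀`, `C₀ = 1 + ∑_m C_m`, and `ν ≤ C₀ ν'` (`correlationCondition_of_le_mul`).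
[cite: GreenTaoAnnals2008, Proposition 9.10 (proof, pp. 529–530)] -/
theorem correlationCondition_of_shiftBound' {m₀ : ℕ} {ν : (N : ℕ) → ZMod N → ℝ}
    (g : ℕ → ℤ → ℝ) {ε₀ : ℝ} (hε₁ : ε₀ < 1 / 4)
    (hν0 : ∀ N x, 0 ≤ ν N x)
    (hνg : ∀ᶠ N : ℕ in atTop, ∀ x : ZMod N, ν N x ≤ 1 + g N x.val)
    (hg0 : ∀ N n, 0 ≤ g N n)
    (hsupp : ∀ N n, g N n ≠ 0 → ε₀ * N ≤ (n : ℝ) ∧ (n : ℝ) ≤ 2 * ε₀ * N)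
    (hsup : ∀ δ : ℝ, 0 < δ → ∀ᶠ N : ℕ in atTop, ∀ n, g N n ≤ (N : ℝ) ^ δ)
    (hcorr : ∀ m, 1 ≤ m → m ≤ m₀ → ∃ C : ℝ, 0 ≤ C ∧ ∀ᶠ N : ℕ in atTop,
      N.Prime → ∀ h : Fin m → ℤ, Function.Injective h → (∀ i, |h i| ≤ N) →
        ∑ y ∈ range N, ∏ i, g N (y + h i) ≤
          C * N * ∏ p ∈ pairPrimeFactors h, (1 + C * (p : ℝ) ^ (-(1 / 2 : ℝ)))) :
    CorrelationCondition m₀ ν := by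
  classical
  choose! Cf hCf0 hCf using hcorr
  set C₀ : ℝ := 1 + ∑ m ∈ Icc 1 m₀, Cf m with hC₀_def
  have hsum0 : 0 ≤ ∑ m ∈ Icc 1 m₀, Cf m :=
    sum_nonneg fun m hm => hCf0 m (mem_Icc.1 hm).1 (mem_Icc.1 hm).2
  have hC₀1 : 1 ≤ C₀ := le_add_of_nonneg_right hsum0
  have hC₀0 : 0 < C₀ := by linarith
  have hCfC₀ : ∀ m, 1 ≤ m → m ≤ m₀ → Cf m ≤ C₀ := fun m h1 h2 => by
    have := single_le_sum (f := Cf) (fun i hi => hCf0 i (mem_Icc.1 hi).1 (mem_Icc.1 hi).2)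
      (mem_Icc.2 ⟨h1, h2⟩)
    linarith
  -- the rescaled family `ν' = 1 + (ν - 1)/C₀ ≤ 1 + g/C₀`, `ν ≤ C₀ ν'`
  set ν' : (N : ℕ) → ZMod N → ℝ := fun N x => 1 + (ν N x - 1) / C₀ with hν'_def
  set g' : ℕ → ℤ → ℝ := fun N n => g N n / C₀ with hg'_def
  have hνν' : ∀ N x, ν N x ≤ C₀ * ν' N x := by
    intro N x
    simp only [hν'_def]
    rw [mul_add, mul_div_cancel₀ _ hC₀0.ne']
    linarith
  refine correlationCondition_of_le_mul hC₀0.le hν0 hνν' ?_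
  refine correlationCondition_of_shiftBound g' hε₁ ?_ ?_ ?_ ?_ ?_
  · intro N x
    simp only [hν'_def]
    have := hν0 N x
    have h2 : -1 ≤ (ν N x - 1) / C₀ := by
      rw [le_div_iff₀ hC₀0]
      nlinarith
    linarith
  · filter_upwards [hνg] with N hN x
    simp only [hν'_def, hg'_def]
    have := hN x
    gcongr
    linarith
  · intro N n hn
    exact hsupp N n fun h0 => hn (by simp only [hg'_def, h0, zero_div])
  · intro δ hδ
    filter_upwards [hsup δ hδ] with N hN n
    simp only [hg'_def]
    exact (div_le_self (hg0 N n) hC₀1).trans (hN n)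
  · intro m hm1 hm2
    refine ⟨Cf m, hCf0 m hm1 hm2, fun η hη => ?_⟩
    filter_upwards [hCf m hm1 hm2] with N hN hNp h hinj hbdd
    have key := hN hNp h hinj hbdd
    have hprod : ∀ y : ℕ, ∏ i, g' N (y + h i) = (C₀ ^ m)⁻¹ * ∏ i, g N (y + h i) := by
      intro y
      simp only [hg'_def, div_eq_mul_inv]
      rw [prod_mul_distrib, prod_const, card_univ, Fintype.card_fin, inv_pow, mul_comm]
    rw [sum_congr rfl fun y _ => hprod y, ← mul_sum]
    have hCm0 := hCf0 m hm1 hm2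
    have hP0 : 0 ≤ ∏ p ∈ pairPrimeFactors h, (1 + Cf m * (p : ℝ) ^ (-(1 / 2 : ℝ))) :=
      prod_nonneg fun p _ => by positivity
    have hN0 : (0 : ℝ) ≤ N := Nat.cast_nonneg _
    have hratio : (C₀ ^ m)⁻¹ * Cf m ≤ 1 := by
      rw [inv_mul_le_iff₀ (pow_pos hC₀0 m), mul_one]
      exact (hCfC₀ m hm1 hm2).trans (le_self_pow₀ hC₀1 (by omega))
    calc (C₀ ^ m)⁻¹ * ∑ y ∈ range N, ∏ i, g N (y + h i)
        ≤ (C₀ ^ m)⁻¹ * (Cf m * N * ∏ p ∈ pairPrimeFactors h, (1 + Cf m * (p : ℝ) ^ (-(1 / 2 : ℝ)))) := by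
          gcongr
      _ = ((C₀ ^ m)⁻¹ * Cf m) * (N * ∏ p ∈ pairPrimeFactors h, (1 + Cf m * (p : ℝ) ^ (-(1 / 2 : ℝ)))) := by
          ring
      _ ≤ (1 + η) * (N * ∏ p ∈ pairPrimeFactors h, (1 + Cf m * (p : ℝ) ^ (-(1 / 2 : ℝ)))) :=
          mul_le_mul_of_nonneg_right (hratio.trans (by linarith)) (by positivity)
      _ = (1 + η) * N * ∏ p ∈ pairPrimeFactors h, (1 + Cf m * (p : ℝ) ^ (-(1 / 2 : ℝ))) := by ring

/-- `|Λ_{χ,R}(n)| ≤ d(|n|) log R` for `|χ| ≤ 1`, `R ≥ 1`, `n ≠ 0`. [cite: ConlonFoxZhao2014, Definition 8.2] -/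
theorem abs_smoothDivisorSum_le {χ : ℝ → ℝ} (hχ1 : ∀ x, |χ x| ≤ 1) {R : ℝ} (hR : 1 ≤ R) {n : ℤ}
    (hn : n ≠ 0) : |smoothDivisorSum χ R n| ≤ #(n.natAbs.divisors) * Real.log R := by
  classical
  rw [smoothDivisorSum_def]
  have hlogR : 0 ≤ Real.log R := Real.log_nonneg hR
  set F := (Icc 1 ⌊R⌋₊).filter (fun d : ℕ => (d : ℤ) ∣ n) with hF
  rw [abs_mul, abs_of_nonneg hlogR, mul_comm]
  refine mul_le_mul_of_nonneg_right ?_ hlogR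
  calc |∑ d ∈ F, (ArithmeticFunction.moebius d : ℝ) * χ (Real.log d / Real.log R)|
      ≤ ∑ d ∈ F, |(ArithmeticFunction.moebius d : ℝ) * χ (Real.log d / Real.log R)| :=
        abs_sum_le_sum_abs _ _
    _ ≤ ∑ _d ∈ F, (1 : ℝ) := by
        refine sum_le_sum fun d _ => ?_
        rw [abs_mul]
        have hμ : |(ArithmeticFunction.moebius d : ℝ)| ≤ 1 := by
          exact_mod_cast ArithmeticFunction.abs_moebius_le_one
        calc |(ArithmeticFunction.moebius d : ℝ)| * |χ (Real.log d / Real.log R)| ≤ 1 * 1 :=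
              mul_le_mul hμ (hχ1 _) (abs_nonneg _) zero_le_one
          _ = 1 := one_mul _
    _ = #F := by rw [sum_const, nsmul_eq_mul, mul_one]
    _ ≤ #(n.natAbs.divisors) := by
        have hsub : F ⊆ n.natAbs.divisors := fun d hd => by
          obtain ⟨-, hdn⟩ := mem_filter.1 hd
          exact Nat.mem_divisors.2 ⟨Int.natCast_dvd.1 hdn, Int.natAbs_ne_zero.2 hn⟩
        exact_mod_cast card_le_card hsub

/-- **From the exceptional sum to Green–Tao's arithmetic factor:** for `C ≥ 0` and a set `s` of positive
integers, `exp(C ∑_{q ∈ s} 1/q) = ∏ exp(C/q) ≤ ∏_{q ∈ s} (1 + C e^C q^{-1/2})` (`e^x ≤ 1 + x e^x`,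
`1/q ≤ q^{-1/2}`). [cite: GreenTaoAnnals2008, Lemma 9.9 (proof)] -/
theorem exp_mul_sum_inv_le_prod {C : ℝ} (hC : 0 ≤ C) (s : Finset ℕ) (hs : ∀ q ∈ s, 1 ≤ q) :
    Real.exp (C * ∑ q ∈ s, (1 : ℝ) / q) ≤ ∏ q ∈ s, (1 + C * Real.exp C * (q : ℝ) ^ (-(1 / 2 : ℝ))) := by
  -- `e^x ≤ 1 + x e^x` (from `1 - x ≤ e^{-x}`)
  have hexp : ∀ x : ℝ, Real.exp x ≤ 1 + x * Real.exp x := fun x => by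
    have h := Real.one_sub_le_exp_neg x
    have hpos := Real.exp_pos x
    have h2 : (1 - x) * Real.exp x ≤ Real.exp (-x) * Real.exp x := mul_le_mul_of_nonneg_right h hpos.le
    rw [← Real.exp_add, neg_add_cancel, Real.exp_zero] at h2
    nlinarith
  rw [mul_sum, Real.exp_sum]
  refine prod_le_prod (fun q _ => (Real.exp_pos _).le) fun q hq => ?_
  have hq1 : (1 : ℝ) ≤ q := by exact_mod_cast hs q hq
  have hq0 : (0 : ℝ) < q := by linarith
  have hxC : C * (1 / (q : ℝ)) ≤ C := by
    rw [mul_one_div]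
    exact div_le_self hC hq1
  have hinv : 1 / (q : ℝ) ≤ (q : ℝ) ^ (-(1 / 2 : ℝ)) := by
    rw [Real.rpow_neg hq0.le, one_div]
    refine inv_anti₀ (Real.rpow_pos_of_pos hq0 _) ?_
    calc (q : ℝ) ^ (1 / 2 : ℝ) ≤ (q : ℝ) ^ (1 : ℝ) := Real.rpow_le_rpow_of_exponent_le hq1 (by norm_num)
      _ = q := Real.rpow_one _
  calc Real.exp (C * (1 / (q : ℝ))) ≤ 1 + C * (1 / (q : ℝ)) * Real.exp (C * (1 / (q : ℝ))) :=
        hexp _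
    _ ≤ 1 + C * (q : ℝ) ^ (-(1 / 2 : ℝ)) * Real.exp C := by
        gcongr
    _ = 1 + C * Real.exp C * (q : ℝ) ^ (-(1 / 2 : ℝ)) := by ring

/-! ### The shift-correlation bound for the smooth majorant (Green–Tao Prop. 9.6, upper bound) -/

/-- The window part of the smooth majorant, on `ℤ`:
`g_N(n) = (φ(W)/W) Λ_{χ₀,R}(Wn+1)²/(c_{χ₀} log R) · 1_{[ε_k N, 2ε_k N]}(n)`.
[cite: GreenTaoAnnals2008, Proposition 9.10 (proof, the function `g`)] -/
def gtSmoothG (k : ℕ) (w : ℕ → ℕ) (N : ℕ) (n : ℤ) : ℝ :=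
  if eps k * N ≤ (n : ℝ) ∧ (n : ℝ) ≤ 2 * eps k * N then
    (Nat.totient (primorial (w N)) : ℝ) / primorial (w N) *
      smoothDivisorSum gtCutoff (gtSmoothLevel k N) (primorial (w N) * n + 1) ^ 2 /
        (cChi gtCutoff * Real.log (gtSmoothLevel k N))
  else 0

/-- `g_N ≥ 0`. [cite: GreenTaoAnnals2008, Proposition 9.10 (proof)] -/
theorem gtSmoothG_nonneg (k : ℕ) (w : ℕ → ℕ) (N : ℕ) (n : ℤ) : 0 ≤ gtSmoothG k w N n := by
  unfold gtSmoothG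
  split_ifs
  · exact div_nonneg (mul_nonneg (div_nonneg (Nat.cast_nonneg _) (Nat.cast_nonneg _)) (sq_nonneg _))
      (mul_nonneg cChi_gtCutoff_pos.le (log_gtSmoothLevel_nonneg k N))
  · exact le_rfl

/-- If `g_N(n) ≠ 0` then `n` lies in the window. [cite: GreenTaoAnnals2008, Proposition 9.10 (proof)] -/
theorem gtSmoothG_support {k : ℕ} {w : ℕ → ℕ} {N : ℕ} {n : ℤ} (h : gtSmoothG k w N n ≠ 0) :
    eps k * N ≤ (n : ℝ) ∧ (n : ℝ) ≤ 2 * eps k * N := by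
  unfold gtSmoothG at h
  split_ifs at h with hc
  · exact hc
  · exact absurd rfl h

/-- `ν_N(x) ≤ 1 + g_N(x)` (`x` read in `[0, N)`). [cite: GreenTaoAnnals2008, Proposition 9.10 (proof)] -/
theorem gtSmoothMeasure_le_one_add (k : ℕ) (w : ℕ → ℕ) (N : ℕ) (x : ZMod N) :
    gtSmoothMeasure k w N x ≤ 1 + gtSmoothG k w N x.val := by
  have hg := gtSmoothG_nonneg k w N x.val
  unfold gtSmoothMeasure gtSmoothG at *
  simp only [Int.cast_natCast] at *
  split_ifs at * with hc
  · linarith [div_nonneg (mul_nonneg (div_nonneg (Nat.cast_nonneg (Nat.totient (primorial (w N))))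
      (Nat.cast_nonneg (primorial (w N)))) (sq_nonneg (smoothDivisorSum gtCutoff (gtSmoothLevel k N)
        (primorial (w N) * (x.val : ℤ) + 1)))) (mul_nonneg cChi_gtCutoff_pos.le (log_gtSmoothLevel_nonneg k N))]
  · linarith

/-- `Λ_{χ,R,2} ≥ 0` for `log R ≥ 0`. [cite: GreenTao2010, App. D (definition of `Λ_{χ,R,a}`)] -/
theorem truncDivisorSum_two_nonneg (χ : ℝ → ℝ) {R : ℝ} (hR : 0 ≤ Real.log R) (y : ℤ) :
    0 ≤ truncDivisorSum χ R 2 y := by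
  unfold truncDivisorSum
  positivity

/-- `g_N(z) ≤ ((φ(W)/W)/c_{χ₀}) Λ_{χ₀,R,2}(Wz+1)` (equality on the window, as `Λ_{χ,R}² = log R · Λ_{χ,R,2}`).
[cite: GreenTaoAnnals2008, Proposition 9.10 (proof)] -/
theorem gtSmoothG_le {k : ℕ} {w : ℕ → ℕ} {N : ℕ} (hlogR : 0 < Real.log (gtSmoothLevel k N)) (z : ℤ) :
    gtSmoothG k w N z ≤ (Nat.totient (primorial (w N)) : ℝ) / primorial (w N) / cChi gtCutoff *
      truncDivisorSum gtCutoff (gtSmoothLevel k N) 2 ((primorial (w N) : ℤ) * z + 1) := by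
  have hc := cChi_gtCutoff_pos
  unfold gtSmoothG
  split_ifs
  · rw [EnvelopingSieveGY.truncDivisorSum_two_eq gtCutoff hlogR.ne']
    apply le_of_eq
    field_simp
  · exact mul_nonneg (by positivity) (truncDivisorSum_two_nonneg _ hlogR.le _)

/-- The exceptional primes of the correlation system are among the prime factors of the pairwise
differences: `{q > w : q ∣ ∏_{i<j} |h_i - h_j|} ⊆ ⋃_{i ≠ j} primeFactors |h_i - h_j|` (distinct `h_i`).
[cite: GreenTaoAnnals2008, Proposition 9.6 (the modulus `Δ`)] -/
theorem roughPrimeFactors_excModulus_subset {m : ℕ} (w : ℕ) {h : Fin m → ℤ} (hinj : Function.Injective h) :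
    roughPrimeFactors w (EnvelopingSieveGY.excModulus h) ⊆ pairPrimeFactors h := by
  classical
  intro q hq
  unfold roughPrimeFactors at hq
  obtain ⟨hq', -⟩ := mem_filter.1 hq
  obtain ⟨hqp, hqd, -⟩ := Nat.mem_primeFactors.1 hq'
  unfold EnvelopingSieveGY.excModulus at hqd
  obtain ⟨p, hp, hdvd⟩ := (Nat.Prime.prime hqp).dvd_finsetProd_iff _ |>.1 hqd
  have hlt : p.1 < p.2 := by
    unfold EnvelopingSieveGY.pairs at hp
    exact (mem_filter.1 hp).2
  rw [pairPrimeFactors_def, mem_biUnion]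
  refine ⟨p, mem_univ _, Nat.mem_primeFactors.2 ⟨hqp, hdvd, ?_⟩⟩
  exact Int.natAbs_ne_zero.2 (sub_ne_zero.2 fun heq => hlt.ne (hinj heq))

/-- **The Goldston–Yıldırım shift-correlation bound for the smooth majorant** (the rôle of Green–Tao's
Prop. 9.6 in the proof of Prop. 9.10, as an `O(1)` upper bound): for `1 ≤ m ≤ 2^{k-1}`, `w → ∞` with
`w ≤ (log R)^{1/8}`, and distinct integer shifts `|h_i| ≤ N`,
`∑_{y<N} ∏_i g_N(y + h_i) ≤ C N ∏_{p ∣ Δ} (1 + C p^{-1/2})`. From the tree's PROVED fixed-data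
correlation estimate of the enveloping-sieve layer (`EnvelopingSieveGY.corr_fixed_bound`, Green–Tao 2010
App. D / CFZ §9: `(φ(W)/W)^m ∑_{|n| ≤ N} ∏_j Λ_{χ₀,R,2}(W(n+h_j)+1) ≤ 3C₁e^{δ}e^{δX}N`,
`X = ∑_{q > w, q ∣ Δ} 1/q`, valid as `R^{5m} ≤ N`), with `e^{δX} ≤ ∏_{q ∣ Δ}(1 + δe^{δ} q^{-1/2})`.
[cite: GreenTaoAnnals2008, Proposition 9.6] [cite: GreenTao2010, App. D (proof of Prop. 6.4, the
correlation estimate)] -/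
theorem gtSmooth_shiftBound {k : ℕ} (hk : 1 ≤ k) {m : ℕ} (hm : m ≤ 2 ^ (k - 1))
    {w : ℕ → ℕ} (hw : Tendsto w atTop atTop)
    (hwR : ∀ N, (w N : ℝ) ≤ Real.log (gtSmoothLevel k N) ^ (1 / 8 : ℝ)) :
    ∃ C : ℝ, 0 ≤ C ∧ ∀ᶠ N : ℕ in atTop, N.Prime → ∀ h : Fin m → ℤ, Function.Injective h →
      (∀ i, |h i| ≤ N) →
      ∑ y ∈ range N, ∏ i, gtSmoothG k w N (y + h i) ≤
        C * N * ∏ p ∈ pairPrimeFactors h, (1 + C * (p : ℝ) ^ (-(1 / 2 : ℝ))) := by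
  classical
  obtain ⟨δ₀, K₀, hδ₀pos, hK₀, hζ⟩ := CFZ.norm_zetaRatio_sub_le
  obtain ⟨CD, hCD0, hDomAll⟩ := EnvelopingSieveGY.exists_corr_dominator
  obtain ⟨K₁, hK₁, hsmall⟩ := EnvelopingSieveGY.corr_smallness m hδ₀pos hK₀
  -- constants
  set c : ℝ := cChi gtCutoff with hc_def
  have hc0 : 0 < c := cChi_gtCutoff_pos
  set M₂ : ℝ := ∫ x, CFZ.phiWeight gtCutoff x with hM₂_def
  set MA : ℝ := CFZ.weightMoment gtCutoff (14 * m + 2) with hMA_def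
  set dC : ℝ := CFZ.deltaConst m with hdC_def
  set C₁ : ℝ := 4 * M₂ ^ (2 * m) + (1 + CD) ^ (3 * m) * ((2 * m : ℕ) * MA * M₂ ^ (2 * m - 1)) + 1
    with hC₁_def
  have hM₂0 : 0 ≤ M₂ := integral_nonneg (CFZ.phiWeight_nonneg gtCutoff)
  have hMA0 : 0 ≤ MA := CFZ.weightMoment_nonneg gtCutoff _
  have hdC0 : 0 ≤ dC := CFZ.deltaConst_nonneg m
  have hC₁0 : 0 < C₁ := by positivity
  set Cbig : ℝ := (c ^ m)⁻¹ * (3 * C₁ * Real.exp dC) with hCbig_def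
  have hCbig0 : 0 ≤ Cbig := by positivity
  set C : ℝ := max Cbig (dC * Real.exp dC) with hC_def
  have hCbigC : Cbig ≤ C := le_max_left _ _
  have hdCC : dC * Real.exp dC ≤ C := le_max_right _ _
  have hC0 : 0 ≤ C := hCbig0.trans hCbigC
  refine ⟨C, hC0, ?_⟩
  filter_upwards [(tendsto_log_gtSmoothLevel hk).eventually_ge_atTop K₁,
    hw.eventually_ge_atTop (21 * m + 2), eventually_ge_atTop 1] with N hK₁R hw21 hN1 hNp h hinj hbdd
  -- the data at level `N`
  set R : ℝ := gtSmoothLevel k N with hR_def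
  have hR0 : 0 < R := gtSmoothLevel_pos hN1
  have hK1 : 1 ≤ Real.log R := hK₁.trans hK₁R
  have hlogR : 0 < Real.log R := by linarith
  have hR5 : R ^ (5 * m) ≤ N := gtSmoothLevel_pow_five_le hk hm hN1
  have hw1 : 1 ≤ w N := by omega
  have hN0 : (0 : ℝ) < N := by exact_mod_cast hN1
  have hW0 : (0 : ℝ) < primorial (w N) := by exact_mod_cast primorial_pos (w N)
  have hφ0 : (0 : ℝ) < Nat.totient (primorial (w N)) := by
    exact_mod_cast Nat.totient_pos.2 (primorial_pos (w N))
  obtain ⟨hδ₀', hδw, hβ, hα⟩ := hsmall R hK₁R (w N) hw1 (hwR N)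
  have hb : ∀ j : Fin m, Nat.Coprime ((fun _ => 1 : Fin m → ℕ) j) (primorial (w N)) := fun j =>
    Nat.coprime_one_left _
  have hk0 : ∀ j : Fin m, (EnvelopingSieveGY.midPrimorial (w N) ⌊R⌋₊ : ℤ) ∣
      (primorial (w N) : ℤ) * (fun _ => (0 : ℤ)) j + 1 - ((fun _ => 1 : Fin m → ℕ) j : ℕ) := fun j => by
    simp
  have he : Function.Injective (fun j => h j + (fun _ => (0 : ℤ)) j) := by simpa using hinj
  have hDom := hDomAll m R hR0 hK1 (w N) hw21 _ he
  have hfix := EnvelopingSieveGY.corr_fixed_bound (χ := gtCutoff) (m := m) (b := fun _ => 1) (h := h)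
    (k := fun _ => 0) contDiff_gtCutoff (fun x hx => gtCutoff_eq_zero hx) abs_gtCutoff_le_one hR0 hK1 hN1
    hR5 hw21 hb hk0 he hK₀ hζ hδ₀' hδw hβ hα hCD0 hDom
  have hfix' : ((Nat.totient (primorial (w N)) : ℝ) / primorial (w N)) ^ m *
      ∑ n ∈ Ico (-(N : ℤ)) (-(N : ℤ) + ((2 * N + 1 : ℕ) : ℤ)),
        ∏ j, truncDivisorSum gtCutoff R 2 ((primorial (w N) : ℤ) * (n + h j) + 1) ≤
      3 * C₁ * (Real.exp dC * Real.exp (dC * EnvelopingSieveGY.excSum (w N) h)) * N := by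
    simpa only [Nat.cast_one, add_zero] using hfix
  -- pointwise domination of `g` and positivity
  have hgle : ∀ z : ℤ, gtSmoothG k w N z ≤ (Nat.totient (primorial (w N)) : ℝ) / primorial (w N) / c *
      truncDivisorSum gtCutoff R 2 ((primorial (w N) : ℤ) * z + 1) := fun z => gtSmoothG_le hlogR z
  have hT0 : ∀ z : ℤ, 0 ≤ truncDivisorSum gtCutoff R 2 z := fun z => truncDivisorSum_two_nonneg _ hlogR.le z
  set φW : ℝ := (Nat.totient (primorial (w N)) : ℝ) / primorial (w N) with hφW_def
  have hφW0 : 0 < φW := by positivity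
  -- the arithmetic factor
  have harith : Real.exp (dC * EnvelopingSieveGY.excSum (w N) h) ≤
      ∏ p ∈ pairPrimeFactors h, (1 + C * (p : ℝ) ^ (-(1 / 2 : ℝ))) := by
    unfold EnvelopingSieveGY.excSum
    have hs : ∀ q ∈ roughPrimeFactors (w N) (EnvelopingSieveGY.excModulus h), 1 ≤ q := by
      intro q hq
      unfold roughPrimeFactors at hq
      exact (Nat.prime_of_mem_primeFactors (mem_filter.1 hq).1).one_le
    calc Real.exp (dC * ∑ q ∈ roughPrimeFactors (w N) (EnvelopingSieveGY.excModulus h), (1 : ℝ) / q)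
        ≤ ∏ q ∈ roughPrimeFactors (w N) (EnvelopingSieveGY.excModulus h),
            (1 + dC * Real.exp dC * (q : ℝ) ^ (-(1 / 2 : ℝ))) := exp_mul_sum_inv_le_prod hdC0 _ hs
      _ ≤ ∏ q ∈ roughPrimeFactors (w N) (EnvelopingSieveGY.excModulus h), (1 + C * (q : ℝ) ^ (-(1 / 2 : ℝ))) :=
          prod_le_prod (fun q _ => by positivity) fun q _ => by gcongr
      _ ≤ ∏ p ∈ pairPrimeFactors h, (1 + C * (p : ℝ) ^ (-(1 / 2 : ℝ))) :=
          prod_le_prod_of_subset_of_one_le (roughPrimeFactors_excModulus_subset (w N) hinj)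
            (fun p _ => by positivity) (fun p _ _ => le_add_of_nonneg_right (by positivity))
  -- the main chain
  calc ∑ y ∈ range N, ∏ i, gtSmoothG k w N (y + h i)
      ≤ ∑ y ∈ range N, ∏ i, (φW / c * truncDivisorSum gtCutoff R 2 ((primorial (w N) : ℤ) * (y + h i) + 1)) :=
        sum_le_sum fun y _ => prod_le_prod (fun i _ => gtSmoothG_nonneg k w N _) (fun i _ => hgle _)
    _ = (φW / c) ^ m * ∑ y ∈ range N, ∏ i, truncDivisorSum gtCutoff R 2 ((primorial (w N) : ℤ) * (y + h i) + 1) := by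
        rw [mul_sum]
        refine sum_congr rfl fun y _ => ?_
        rw [prod_mul_distrib, prod_const, card_univ, Fintype.card_fin]
    _ = (φW / c) ^ m * ∑ x ∈ Ico (0 : ℤ) N, ∏ i, truncDivisorSum gtCutoff R 2 ((primorial (w N) : ℤ) * (x + h i) + 1) := by
        congr 1
        refine sum_nbij (fun y : ℕ => (y : ℤ)) (fun y hy => mem_Ico.2 ⟨by positivity, ?_⟩)
          (fun a _ b _ hab => Nat.cast_injective hab) (fun x hx => ?_) (fun y _ => rfl)
        · exact_mod_cast mem_range.1 hy
        · obtain ⟨h0, h1⟩ := mem_Ico.1 (mem_coe.1 hx)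
          refine ⟨x.toNat, mem_coe.2 (mem_range.2 ?_), Int.toNat_of_nonneg h0⟩
          omega
    _ ≤ (φW / c) ^ m * ∑ n ∈ Ico (-(N : ℤ)) (-(N : ℤ) + ((2 * N + 1 : ℕ) : ℤ)),
          ∏ j, truncDivisorSum gtCutoff R 2 ((primorial (w N) : ℤ) * (n + h j) + 1) := by
        refine mul_le_mul_of_nonneg_left (sum_le_sum_of_subset_of_nonneg (fun x hx => ?_)
          fun n _ _ => prod_nonneg fun j _ => hT0 _) (by positivity)
        rw [mem_Ico] at hx ⊢
        push_cast
        constructor <;> linarith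
    _ = (c ^ m)⁻¹ * (φW ^ m * ∑ n ∈ Ico (-(N : ℤ)) (-(N : ℤ) + ((2 * N + 1 : ℕ) : ℤ)),
          ∏ j, truncDivisorSum gtCutoff R 2 ((primorial (w N) : ℤ) * (n + h j) + 1)) := by
        rw [div_pow]; ring
    _ ≤ (c ^ m)⁻¹ * (3 * C₁ * (Real.exp dC * Real.exp (dC * EnvelopingSieveGY.excSum (w N) h)) * N) := by
        gcongr
    _ = Cbig * N * Real.exp (dC * EnvelopingSieveGY.excSum (w N) h) := by rw [hCbig_def]; ring
    _ ≤ C * N * ∏ p ∈ pairPrimeFactors h, (1 + C * (p : ℝ) ^ (-(1 / 2 : ℝ))) := by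
        gcongr

/-! ### The correlation condition (Green–Tao Prop. 9.10) for the smooth majorant -/

/-- **The `2^{k-1}`-correlation condition for the smooth majorant**, for `w → ∞` below the growth bound
`G(N) = min(⌊(log R)^{1/8}⌋, ⌊log_4 log N⌋)` — the printed proof of Proposition 9.10 (pp. 529–530) in
the generic form `correlationCondition_of_shiftBound'`: `ν ≤ 1 + g`,
`g_N(n) = (φ(W)/W) Λ_{χ₀,R}(Wn+1)²/(c_{χ₀} log R) · 1_{[ε_k N, 2ε_k N]}(n)`, `‖g_N‖_∞ ≤ N^{o(1)}` by
`|Λ_{χ₀,R}(n)| ≤ d(n) log R` and the divisor bound (`exists_card_divisors_le_mul_rpow`, in place of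
the maximal-order bound quoted on p. 529), and the shift bound `gtSmooth_shiftBound` (the rôle of
Prop. 9.6). [cite: GreenTaoAnnals2008, Proposition 9.10] -/
theorem gtSmoothMeasure_correlationCondition {k : ℕ} (hk : 3 ≤ k) :
    ∃ G : ℕ → ℕ, Tendsto G atTop atTop ∧ ∀ w : ℕ → ℕ, Tendsto w atTop atTop → (∀ N, w N ≤ G N) →
      CorrelationCondition (2 ^ (k - 1)) (gtSmoothMeasure k w) := by
  classical
  have hk1 : 1 ≤ k := by omega
  set G₁ : ℕ → ℕ := fun N => ⌊Real.log (gtSmoothLevel k N) ^ (1 / 8 : ℝ)⌋₊ with hG₁_def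
  have hG₁ : Tendsto G₁ atTop atTop :=
    tendsto_nat_floor_atTop.comp ((tendsto_rpow_atTop (by norm_num)).comp (tendsto_log_gtSmoothLevel hk1))
  have hfl : Tendsto (fun N : ℕ => ⌊Real.logb 4 (Real.log N)⌋₊) atTop atTop :=
    tendsto_nat_floor_atTop.comp ((Real.tendsto_logb_atTop (by norm_num)).comp
      (Real.tendsto_log_atTop.comp tendsto_natCast_atTop_atTop))
  refine ⟨fun N => min (G₁ N) ⌊Real.logb 4 (Real.log N)⌋₊, tendsto_inf_atTop atTop hG₁ hfl,
    fun w hw hwG => ?_⟩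
  have hwR : ∀ N, (w N : ℝ) ≤ Real.log (gtSmoothLevel k N) ^ (1 / 8 : ℝ) := fun N =>
    (show (w N : ℝ) ≤ (G₁ N : ℝ) by exact_mod_cast (hwG N).trans (min_le_left _ _)).trans
      (Nat.floor_le (Real.rpow_nonneg (log_gtSmoothLevel_nonneg k N) _))
  have hwlog : ∀ N, w N ≤ ⌊Real.logb 4 (Real.log N)⌋₊ := fun N => (hwG N).trans (min_le_right _ _)
  have hε : eps k < 1 / 4 := by linarith [eps_le k]
  -- shared eventualities
  have hlogR1 : ∀ᶠ N : ℕ in atTop, 1 ≤ Real.log (gtSmoothLevel k N) :=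
    (tendsto_log_gtSmoothLevel hk1).eventually_ge_atTop 1
  have hWN : ∀ᶠ N : ℕ in atTop, (primorial (w N) : ℝ) ≤ N := by
    filter_upwards [eventually_ge_atTop 3] with N hN3
    have hN3' : (3 : ℝ) ≤ N := by exact_mod_cast hN3
    exact (primorial_le_log hN3 (hwlog N)).trans
      ((Real.log_le_sub_one_of_pos (by linarith)).trans (by linarith))
  refine correlationCondition_of_shiftBound' (gtSmoothG k w) hε (gtSmoothMeasure_nonneg k w)
    (Eventually.of_forall fun N x => gtSmoothMeasure_le_one_add k w N x) (gtSmoothG_nonneg k w)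
    (fun N n hn => gtSmoothG_support hn) ?_ ?_
  · ---------------------------------------------------------------- `‖g_N‖_∞ ≤ N^δ`
    intro δ hδ
    have hδ' : 0 < δ / 16 := by positivity
    obtain ⟨C₁, hC₁, hd⟩ := Literature.NumberTheory.Sieve.exists_card_divisors_le_mul_rpow hδ'
    have e2 : ∀ᶠ N : ℕ in atTop, Real.log N ≤ (N : ℝ) ^ (δ / 16) := by
      have h := (isLittleO_log_rpow_atTop hδ').bound (show (0 : ℝ) < 1 by norm_num)
      filter_upwards [tendsto_natCast_atTop_atTop.eventually h, eventually_ge_atTop 1] with N hN hN1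
      rw [one_mul, Real.norm_eq_abs, Real.norm_eq_abs,
        abs_of_nonneg (Real.log_nonneg (by exact_mod_cast hN1)), abs_of_nonneg (by positivity)] at hN
      exact hN
    have e3 : ∀ᶠ N : ℕ in atTop, C₁ ^ 2 ≤ (N : ℝ) ^ (δ / 2) :=
      ((tendsto_rpow_atTop (show 0 < δ / 2 by positivity)).comp
        tendsto_natCast_atTop_atTop).eventually_ge_atTop _
    filter_upwards [hlogR1, e2, e3, hWN, eventually_ge_atTop 2] with N h1 h2 h3 h4 hN2 n
    unfold gtSmoothG
    split_ifs with hc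
    swap
    · positivity
    obtain ⟨hc1, hc2⟩ := hc
    have hN0 : (0 : ℝ) < N := by exact_mod_cast (show 0 < N by omega)
    have hN1 : (1 : ℝ) ≤ N := by exact_mod_cast (show 1 ≤ N by omega)
    have hn0 : (0 : ℝ) ≤ n := le_trans (mul_nonneg (eps_pos k).le hN0.le) hc1
    have hnN : (n : ℝ) ≤ N := by
      have := two_mul_eps_lt_one k
      calc (n : ℝ) ≤ 2 * eps k * N := hc2
        _ ≤ 1 * N := by gcongr
        _ = N := one_mul _
    have hn0' : (0 : ℤ) ≤ n := by exact_mod_cast hn0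
    set W : ℕ := primorial (w N) with hW_def
    set n' : ℤ := (W : ℤ) * n + 1 with hn'_def
    have hW1 : (1 : ℤ) ≤ W := by exact_mod_cast primorial_pos (w N)
    have hn'1 : 1 ≤ n' := by
      have : 0 ≤ (W : ℤ) * n := mul_nonneg (by linarith) hn0'
      linarith
    have hn'0 : n' ≠ 0 := by linarith
    -- `|n'| ≤ N³`
    have hn'le : ((n'.natAbs : ℕ) : ℝ) ≤ (N : ℝ) ^ (3 : ℕ) := by
      have habs : ((n'.natAbs : ℕ) : ℝ) = ((n' : ℤ) : ℝ) := by
        rw [Nat.cast_natAbs, Int.cast_abs, abs_of_pos (by exact_mod_cast hn'1)]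
      rw [habs, hn'_def]
      push_cast
      have h2N : (2 : ℝ) ≤ N := by exact_mod_cast hN2
      nlinarith [mul_le_mul h4 hnN hn0 hN0.le]
    -- `|Λ_{χ₀,R}(n')| ≤ d(n') log R ≤ C₁ N^{3δ/16} N^{δ/16}`
    have hR1 : 1 ≤ gtSmoothLevel k N := one_le_gtSmoothLevel (by omega)
    have hR0 : 0 < gtSmoothLevel k N := by linarith
    have hlogR : Real.log (gtSmoothLevel k N) ≤ Real.log N := by
      rw [log_gtSmoothLevel]
      have hγ1 : gtSmoothExp k ≤ 1 := (gtSmoothExp_le hk1).trans (by norm_num)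
      have hlogN : 0 ≤ Real.log N := Real.log_nonneg hN1
      calc gtSmoothExp k * Real.log N ≤ 1 * Real.log N := by gcongr
        _ = Real.log N := one_mul _
    have hΛ := abs_smoothDivisorSum_le abs_gtCutoff_le_one hR1 hn'0
    have hdiv := hd n'.natAbs (Int.natAbs_ne_zero.2 hn'0)
    have hD : (#(n'.natAbs.divisors) : ℝ) ≤ C₁ * (N : ℝ) ^ (3 * (δ / 16)) := by
      calc (#(n'.natAbs.divisors) : ℝ) ≤ C₁ * ((n'.natAbs : ℕ) : ℝ) ^ (δ / 16) := hdiv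
        _ ≤ C₁ * ((N : ℝ) ^ (3 : ℕ)) ^ (δ / 16) := by gcongr
        _ = C₁ * (N : ℝ) ^ (3 * (δ / 16)) := by
            rw [← Real.rpow_natCast, ← Real.rpow_mul hN0.le]; norm_num
    have hΛ' : |smoothDivisorSum gtCutoff (gtSmoothLevel k N) n'| ≤ C₁ * (N : ℝ) ^ (4 * (δ / 16)) := by
      calc |smoothDivisorSum gtCutoff (gtSmoothLevel k N) n'|
          ≤ #(n'.natAbs.divisors) * Real.log (gtSmoothLevel k N) := hΛ
        _ ≤ (C₁ * (N : ℝ) ^ (3 * (δ / 16))) * (N : ℝ) ^ (δ / 16) :=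
            mul_le_mul hD (hlogR.trans h2) (by linarith) (by positivity)
        _ = C₁ * (N : ℝ) ^ (4 * (δ / 16)) := by
            rw [show 4 * (δ / 16) = 3 * (δ / 16) + δ / 16 by ring, Real.rpow_add hN0]; ring
    have hΛ2 : smoothDivisorSum gtCutoff (gtSmoothLevel k N) n' ^ 2 ≤ C₁ ^ 2 * (N : ℝ) ^ (δ / 2) := by
      calc smoothDivisorSum gtCutoff (gtSmoothLevel k N) n' ^ 2
          = |smoothDivisorSum gtCutoff (gtSmoothLevel k N) n'| ^ 2 := (sq_abs _).symm
        _ ≤ (C₁ * (N : ℝ) ^ (4 * (δ / 16))) ^ 2 := pow_le_pow_left₀ (abs_nonneg _) hΛ' 2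
        _ = C₁ ^ 2 * ((N : ℝ) ^ (4 * (δ / 16))) ^ 2 := mul_pow _ _ _
        _ = C₁ ^ 2 * (N : ℝ) ^ (δ / 2) := by
            congr 1
            rw [← Real.rpow_natCast, ← Real.rpow_mul hN0.le]
            ring_nf
    -- assemble: `(φ/W)/(c log R) ≤ 1` as `c ≥ 1`, `log R ≥ 1`
    have hφW : (Nat.totient W : ℝ) / W ≤ 1 :=
      div_le_one_of_le₀ (by exact_mod_cast Nat.totient_le W) (Nat.cast_nonneg _)
    have hclog : 1 ≤ cChi gtCutoff * Real.log (gtSmoothLevel k N) := by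
      have := one_le_cChi_gtCutoff
      nlinarith
    calc (Nat.totient W : ℝ) / W * smoothDivisorSum gtCutoff (gtSmoothLevel k N) n' ^ 2 /
          (cChi gtCutoff * Real.log (gtSmoothLevel k N))
        ≤ 1 * smoothDivisorSum gtCutoff (gtSmoothLevel k N) n' ^ 2 / 1 := by gcongr
      _ = smoothDivisorSum gtCutoff (gtSmoothLevel k N) n' ^ 2 := by ring
      _ ≤ C₁ ^ 2 * (N : ℝ) ^ (δ / 2) := hΛ2
      _ ≤ (N : ℝ) ^ (δ / 2) * (N : ℝ) ^ (δ / 2) := by gcongr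
      _ = (N : ℝ) ^ δ := by rw [← Real.rpow_add hN0]; ring_nf
  · ---------------------------------------------------------------- the shift bound
    intro m _hm1 hm2
    exact gtSmooth_shiftBound hk1 hm2 hw hwR

/-! ### Proposition 9.1, discharged -/

/-- **Green–Tao 2008, Proposition 9.1 — DISCHARGED** (`PseudorandomMajorant_holds`): for `k ≥ 3` and
`w → ∞` below a growth bound there is a `k`-pseudorandom family (Definition 3.3: the
`(k 2^{k-1}, 3k-4, k)`-linear forms condition and the `2^{k-1}`-correlation condition) majorising
`k⁻¹ 2^{-k-5} Λ̃` on `[ε_k N, 2ε_k N]` for all large primes `N`. The majorant is Green–Tao's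
Definition 9.3 with Tao's smoothly truncated divisor sum `Λ_{χ₀,R}` (Green–Tao 2010 App. D;
Conlon–Fox–Zhao Def. 8.2) for the explicit cutoff `χ₀ = sT(· + 1) sT(1 - ·)`, normalised by
`c_{χ₀} log R`, at the level `R = N^{γ_k}`, `γ_k = c_{χ₀} k⁻¹2^{-k-4}` (so that `log R/c_{χ₀}` is the
printed `log R` of Def. 9.3, which makes Lemma 9.4 hold with the printed constant `k⁻¹2^{-k-5}`, while
`1 ≤ c_{χ₀} ≤ 2` keeps `R^{10 k 2^{k-1}} ≤ N^{5/8}`); its pseudorandomness (Props. 9.8 and 9.10 of the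
source) is `gtSmoothMeasure_linearFormsCondition` and `gtSmoothMeasure_correlationCondition`, resting
on the tree's PROVED smooth Goldston–Yıldırım estimates (CFZ Prop. 8.3 / Green–Tao 2010 Thm. D.3) in
place of the contour-integral Props. 9.5–9.6 of §10; the assembly is the printed one (p. 530), with
the growth bound `G = min(G_{9.8}, G_{9.10}, ⌊log_4 log N⌋)` (the last term gives `W ≤ log N ≤ N`,
the slowness used in Lemma 9.4). [cite: GreenTaoAnnals2008, Proposition 9.1]
[cite: ConlonFoxZhao2014, Propositions 8.1–8.4] [cite: GreenTao2010, App. D, Thm. D.3] -/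
theorem PseudorandomMajorant_holds : PseudorandomMajorant := by
  intro k hk
  have hk1 : 1 ≤ k := by omega
  obtain ⟨G₁, hG₁, H₁⟩ := gtSmoothMeasure_linearFormsCondition hk
  obtain ⟨G₂, hG₂, H₂⟩ := gtSmoothMeasure_correlationCondition hk
  have hfl : Tendsto (fun N : ℕ => ⌊Real.logb 4 (Real.log N)⌋₊) atTop atTop :=
    tendsto_nat_floor_atTop.comp ((Real.tendsto_logb_atTop (by norm_num)).comp
      (Real.tendsto_log_atTop.comp tendsto_natCast_atTop_atTop))
  refine ⟨fun N => min (min (G₁ N) (G₂ N)) ⌊Real.logb 4 (Real.log N)⌋₊,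
    tendsto_inf_atTop atTop (tendsto_inf_atTop atTop hG₁ hG₂) hfl, fun w hw hwG => ?_⟩
  have hw₁ : ∀ N, w N ≤ G₁ N := fun N => (hwG N).trans ((min_le_left _ _).trans (min_le_left _ _))
  have hw₂ : ∀ N, w N ≤ G₂ N := fun N => (hwG N).trans ((min_le_left _ _).trans (min_le_right _ _))
  have hw₃ : ∀ N, w N ≤ ⌊Real.logb 4 (Real.log N)⌋₊ := fun N => (hwG N).trans (min_le_right _ _)
  refine ⟨gtSmoothMeasure k w, ⟨gtSmoothMeasure_nonneg k w, H₁ w hw hw₁, H₂ w hw hw₂⟩, ?_⟩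
  -- Lemma 9.4, for `N` large: `R ≥ 1`, `R < ε_k N`, `W ≤ log N ≤ N`
  have hRε : ∀ᶠ N : ℕ in atTop, gtSmoothLevel k N < eps k * N := by
    filter_upwards [(tendsto_gtSmoothLevel_div_atTop hk1).eventually (gt_mem_nhds (eps_pos k)),
      eventually_ge_atTop 1] with N hN hN1
    have hN0 : (0 : ℝ) < N := by exact_mod_cast hN1
    rwa [div_lt_iff₀ hN0] at hN
  filter_upwards [hRε, eventually_ge_atTop 3] with N hRεN hN3 _hNp n h1 h2
  have hN3' : (3 : ℝ) ≤ N := by exact_mod_cast hN3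
  have hWN : primorial (w N) ≤ N := by
    have h := primorial_le_log hN3 (hw₃ N)
    have hlog : Real.log N ≤ N := (Real.log_le_sub_one_of_pos (by linarith)).trans (by linarith)
    exact_mod_cast h.trans hlog
  exact gtSmoothMeasure_majorises hk1 hWN (one_le_gtSmoothLevel (by omega)) hRεN h1 h2

end Literature.NumberTheory.Sieve.GreenTao2008
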